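import Mathlib
import Literature.Combinatorics.Sahi2008.Functional
import Literature.Probability.Percolation.ConditionalPositiveAssociationProofs

/-!
# Sahi (2008), Theorems 1 and 2: `E_n ≥ 0` on the cumulation cone under a product measure
(every `n`), with Proposition 12 (polarization)

CITATION HEADER.  Source: S. Sahi, *Higher correlation inequalities*, Combinatorica **28** (2)
(2008) 209–227 [Sahi2008] — read 2026-08-19 from the author's reprint
(`https://sites.math.rutgers.edu/~sahi/Reprints/08highercorrelation.pdf`, corpus
`paper:url-5f6060b183b5`; journal page = 208 + file page).  The functional `E_n` is the tree's
`Literature.Combinatorics.Sahi2008.sahiE` (file `Sahi2008/Functional.lean`, defined by the Lieb–Sahi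
recursion [LiebSahi2021, Prop. 3.3]).

## What is reproduced (everything below is PROVED; no facts, no conjectures)

Setting [Sahi2008, p. 210]: `X` a finite set (here a `Fintype ι`), the Boolean lattice `2^X` (here
`Finset ι`), the product probability measure (2) `μ(S) = ∏_{x∈S} m_x ∏_{y∉S} (1 - m_y)` with
`m_x ∈ [0,1]` (`finsetProdWeight m`), and the CUMULATION CONE
`𝒞[X] = {F⁺ | F ≥ 0}`, `F⁺(T) = Σ_{S ⊆ T} F(S)` (eq. (1)) — equivalently the nonnegative combinations
of indicators of principal up-sets `{T : S ⊆ T}` (`IsCumulation`; `isCumulation_indicator_supset`,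
closure under `+`, nonnegative scalars and products = [Sahi2008, Lemma 11]; `𝒞 ⊆ ℐ ⊆ 𝒫`:
`IsCumulation.monotone/nonneg`).

* **Theorem 2** [Sahi2008, Thm. 2 (p. 211)] `sahi2008_thm2`: for every `n` and every `n`-tuple
  `f_0,…,f_{n-1} ∈ 𝒞[X]`, `E_n(f_0,…,f_{n-1}) ≥ 0` under the product measure — the case of Sahi's
  Conjecture 5 (= Lieb–Sahi Conj. 1.1) that is PROVED in print for every `n`.  Also on the lattice
  `Set ι` with the weight `Literature.Probability.Percolation.BHK2006.weight m` (`sahi2008_thm2_set`).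
* **Theorem 1** [Sahi2008, Thm. 1 (p. 210)] `sahi2008_thm1` (square-free form, see below): for a
  `𝒞`-valued `G` without constant terms every coefficient of `1 - ∏_S (1 - G(S))^{μ(S)}` is `≥ 0`.
  The proof is Sahi's induction on `|X|` [pp. 215–219]: the one-variable elimination (12)
  `1 - F_x(T) = (1 - ρ⁻_x F(T))^{1-m_x} (1 - ρ⁺_x F(T))^{m_x}` and the expansion (p. 218)
  `F_x = ρ⁻_x F + Σ_{i≥1} (-1)^{i-1} C(m_x,i) [δ_x F]^i [1 - ρ⁻_x F]^{1-i}` with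
  `(-1)^{i-1} C(m_x, i) = m_x(1-m_x)(2-m_x)⋯(i-1-m_x)/i! ≥ 0` (`neg_one_pow_mul_rch_succ_nonneg`),
  `δ_x` preserving `𝒞` [Lemma 7] and `𝒞` closed under products [Lemma 11] (`sahi2008_thm1_aux`,
  `IsCumulOn.mul`, `CVal.*`).
* **Proposition 12** [Sahi2008, Prop. 12 (p. 219), eq. (14)] `sahiE_eq_gfE` / `sahi2008_prop12`:
  `E_n(f_0,…,f_{n-1})` is the coefficient of `t_0 ⋯ t_{n-1}` in `1 - ∏_S (1 - F_n(S))^{μ(S)}`,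
  `F_n = Σ_i t_i f_i` (eq. (13)), for every probability weight `μ` on a finite set.
* **Proposition 15, the core of Lemma 16** [Sahi2008, Prop. 15 (p. 222), Lemma 16 (p. 223), proof
  pp. 225–226] (Part G) `SqFree.nonneg_one_sub_core`: for the sums `c, d, e` of the variables of three
  disjoint blocks and `α, β, γ ≥ 0`, `α + β + γ ≤ 1`, `(α+β)(α+γ) ≤ α`, every coefficient of
  `1 - (1-c)^γ (1-d)^β (1-c-d-e)^α` is `≥ 0` — Sahi's case `a = b = 0`, proved as printed
  (`(1-c-d-e)^α = (1-c)^α(1-d)^α(1-w)^α`, binomial expansion, coefficient comparison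
  `α k l ≥ (α+γ)(α+β)`); read through Proposition 12 it is the EVENT FORM
  `sahiE_nonneg_of_corrPair_labels`: for any probability weight on a finite set and `{0,1}`-valued
  `g₁, g₂` with `E(g₁)E(g₂) ≤ E(g₁g₂)`, `E_n ≥ 0` on every `n`-tuple drawn from `{g₁, g₂, g₁g₂}`.
  The reductions `a = 0`, `b = 0` of Lemma 16 (= peeling constant and absorbing slots) and the
  `|X| ≤ 2` statement itself (`SahiTwoPointLatticeTheorem_holds`) are in `Sahi2008/ProvedCases.lean`.

## Deviations from print (for formalisability; the mathematics is Sahi's)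

1. THE RING.  Sahi works in `R = ℝ[[t]]` (Theorem 1) and `R_n = ℝ[[t_1,…,t_n]]` (Prop. 12) and passes
   from one to the other by the specialisation `t_i = t^{k_i}`, `k_i = (p_1⋯p_n)/p_i` [p. 220–221].
   Since Prop. 12 only ever reads coefficients "of order `≤ 1` in each `t_i`" [p. 220: "the ignored
   terms have order `≥ 2` in some `t_i`"], we work throughout in the SQUARE-FREE algebra
   `ℝ[t_i : i ∈ κ]/(t_i²)` (`SqFree κ ℝ`: coefficient families indexed by `Finset κ`, disjoint-union
   convolution), whose augmentation ideal is nilpotent: all binomial series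
   `(1 - u)^c = Σ_k C(c,k) (-u)^k` (`SqFree.binomB`) are finite sums, and Theorem 1 is proved directly
   in `n` variables, so the specialisation trick of §3.2 is not needed.  The exponent laws of
   `(1-u)^c` for real `c` (Chu–Vandermonde `binomB_mul_binomB_same`, multiplicativity in the base
   `binomB_mul_binomB`, composition `binomB_one_sub_binomB`) are obtained from Pascal's rule and the
   "polynomial identity principle" `SqFree.eq_of_forall_eval_natCast` (an identity polynomial in the
   exponent that holds for all natural exponents holds identically; `Polynomial.eq_zero_of_infinite_isRoot`).
2. PROP. 12.  The tree DEFINES `E_n` by the Lieb–Sahi recursion (slot `0` peeled), so Prop. 12 is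
   proved by showing that the square-free coefficient satisfies that recursion (`gfE_cons`: peel `t_0`
   using `(1-(u+w))^c = (1-u)^c - c w (1-u)^{c-1}` for `w² = 0`, and the branching term through the
   degree derivation `D(t^τ) = |τ| t^τ`), instead of Sahi's `log`/`exp` expansion into set partitions
   [p. 219–220] (the set-partition form of `E_n`, Sahi's (4)–(7), is now the tree theorem
   `sahiE_eq_sahiESetPartition` of `Sahi2008/SetPartitionForm.lean`; it is not used here).
3. GENERALITY.  Theorem 1 is stated for real coefficients of the square-free algebra (Sahi: `𝒫`-valued
   power series); Theorem 2 exactly as printed (product measure, `𝒞[X]`, all `n`).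
   GENERAL FORM (formerly a TODO here, now DISCHARGED): Blinovsky's extension of Theorem 2 from product
   to FKG measures (Probl. Inf. Transm. 50 (2014) = arXiv:1306.0862) is proved — for every `n`, every FKG
   probability weight on a finite distributive lattice, and with TWO slots free — in
   `Sahi2008/FKGCumulation.lean`: `sahiE_nonneg_of_isLatticeCumulation`,
   `sahiE_nonneg_of_isLatticeCumulation_offTwo`, Boolean form `sahi2008_thm2_fkg`.

## Main declarations

`SqFree` (+ `single`, `C`, `map`, `D`, `emb`, `binomB`, `inv1`, nilpotency lemmas), `rch`
(generalised binomial coefficient), `IsCumulOn`/`IsCumulation`/`CVal`, `prodWt`/`finsetProdWeight`,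
`gfE`, `gfE_cons`, `sahiE_eq_gfE`, `sahi2008_thm1_aux`, `sahi2008_thm1`, `sahi2008_prop12`,
`sahi2008_thm2`, `sahiE_comp_equiv`, `sahi2008_thm2_set`; Part G: `SqFree.Nonneg`, `SqFree.bsum`, `SqFree.Nonneg.binomB_of_nonpos`, `SqFree.Nonneg.one_sub_binomB_of_unit`,
`SqFree.binomB_add_add_eq_mul`, `SqFree.nonneg_one_sub_core`, `sahiE_nonneg_of_corrPair_labels`.
-/

set_option autoImplicit false

namespace Literature.Combinatorics.Sahi2008

open Finset

/-! ## Part A.  The square-free algebra `R[t_i : i ∈ ι]/(t_i²)`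

Elements are coefficient families indexed by the square-free monomials `t^τ = ∏_{i∈τ} t_i`,
`τ : Finset ι`; the product is the disjoint-union convolution.  [folklore: the quotient of the
polynomial ring by the squares of the variables] -/

/-- The square-free algebra `R[t_i : i ∈ ι]/(t_i² : i ∈ ι)`: an element is its family of
coefficients on the square-free monomials `t^τ`, `τ : Finset ι`. [cite: Sahi2008, §3.3 (p. 220)] -/
structure SqFree (ι : Type*) (R : Type*) where
  /-- the coefficient of the square-free monomial `t^τ = ∏_{i ∈ τ} t_i` -/
  coeff : Finset ι → R

namespace SqFree

variable {ι : Type*} [DecidableEq ι] {R : Type*} [CommRing R]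

omit [DecidableEq ι] [CommRing R] in
/-- Two elements of the square-free algebra with the same coefficients are equal. [folklore] -/
@[ext] private theorem ext {a b : SqFree ι R} (h : ∀ τ, a.coeff τ = b.coeff τ) : a = b := by
  cases a; cases b; congr; funext τ; exact h τ

omit [DecidableEq ι] [CommRing R] in
/-- Coefficients of an element given by its coefficient function. [folklore] -/
@[simp] private theorem coeff_mk (f : Finset ι → R) (τ : Finset ι) : (SqFree.mk f).coeff τ = f τ := rfl

/-- Zero, coefficientwise. [folklore] -/
instance : Zero (SqFree ι R) := ⟨⟨fun _ => 0⟩⟩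
/-- Addition, coefficientwise. [folklore] -/
instance : Add (SqFree ι R) := ⟨fun a b => ⟨fun τ => a.coeff τ + b.coeff τ⟩⟩
/-- Negation, coefficientwise. [folklore] -/
instance : Neg (SqFree ι R) := ⟨fun a => ⟨fun τ => -a.coeff τ⟩⟩
/-- Subtraction, coefficientwise. [folklore] -/
instance : Sub (SqFree ι R) := ⟨fun a b => ⟨fun τ => a.coeff τ - b.coeff τ⟩⟩
/-- Scalar multiplication by naturals, coefficientwise. [folklore] -/
instance instSMulNat : SMul ℕ (SqFree ι R) := ⟨fun n a => ⟨fun τ => n • a.coeff τ⟩⟩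
/-- Scalar multiplication by integers, coefficientwise. [folklore] -/
instance instSMulInt : SMul ℤ (SqFree ι R) := ⟨fun n a => ⟨fun τ => n • a.coeff τ⟩⟩
/-- The unit: the empty monomial. [folklore] -/
instance : One (SqFree ι R) := ⟨⟨fun τ => if τ = ∅ then 1 else 0⟩⟩
/-- The disjoint-union convolution product. [folklore] -/
instance : Mul (SqFree ι R) :=
  ⟨fun a b => ⟨fun τ => ∑ σ ∈ τ.powerset, a.coeff σ * b.coeff (τ \ σ)⟩⟩

omit [DecidableEq ι] in
/-- Coefficients of `0`. [folklore] -/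
@[simp] private theorem coeff_zero (τ : Finset ι) : (0 : SqFree ι R).coeff τ = 0 := rfl
omit [DecidableEq ι] in
/-- Coefficients are additive. [folklore] -/
@[simp] private theorem coeff_add (a b : SqFree ι R) (τ : Finset ι) :
    (a + b).coeff τ = a.coeff τ + b.coeff τ := rfl
omit [DecidableEq ι] in
/-- Coefficients of a negation. [folklore] -/
@[simp] private theorem coeff_neg (a : SqFree ι R) (τ : Finset ι) : (-a).coeff τ = -a.coeff τ := rfl
omit [DecidableEq ι] in
/-- Coefficients of a difference. [folklore] -/
@[simp] private theorem coeff_sub (a b : SqFree ι R) (τ : Finset ι) :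
    (a - b).coeff τ = a.coeff τ - b.coeff τ := rfl
/-- Coefficients of `1` (the empty monomial). [folklore] -/
private theorem coeff_one (τ : Finset ι) : (1 : SqFree ι R).coeff τ = if τ = ∅ then 1 else 0 := rfl
/-- Coefficients of a product: disjoint-union convolution. [folklore] -/
private theorem coeff_mul (a b : SqFree ι R) (τ : Finset ι) :
    (a * b).coeff τ = ∑ σ ∈ τ.powerset, a.coeff σ * b.coeff (τ \ σ) := rfl

/-- The additive group structure, coefficientwise. [folklore] -/
instance : AddCommGroup (SqFree ι R) :=
  Function.Injective.addCommGroup SqFree.coeff (fun _ _ h => ext (congrFun h)) rfl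
    (fun _ _ => rfl) (fun _ => rfl) (fun _ _ => rfl) (fun _ _ => rfl) (fun _ _ => rfl)

/-- Commutativity of the convolution product. [folklore] -/
protected theorem mul_comm' (a b : SqFree ι R) : a * b = b * a := by
  ext τ
  simp only [coeff_mul]
  refine Finset.sum_nbij' (fun σ => τ \ σ) (fun σ => τ \ σ) ?_ ?_ ?_ ?_ ?_
  · intro σ _; exact mem_powerset.2 sdiff_subset
  · intro σ _; exact mem_powerset.2 sdiff_subset
  · intro σ hσ; exact Finset.sdiff_sdiff_eq_self (mem_powerset.1 hσ)
  · intro σ hσ; exact Finset.sdiff_sdiff_eq_self (mem_powerset.1 hσ)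
  · intro σ hσ; rw [Finset.sdiff_sdiff_eq_self (mem_powerset.1 hσ), mul_comm]

/-- `1` is a left unit. [folklore] -/
protected theorem one_mul' (a : SqFree ι R) : 1 * a = a := by
  ext τ
  simp only [coeff_mul, coeff_one, ite_mul, one_mul, zero_mul, Finset.sum_ite_eq',
    mem_powerset, empty_subset, if_true, sdiff_empty]

/-- `0` is absorbing. [folklore] -/
protected theorem zero_mul' (a : SqFree ι R) : 0 * a = 0 := by
  ext τ; simp [coeff_mul]

/-- Left distributivity. [folklore] -/
protected theorem left_distrib' (a b c : SqFree ι R) : a * (b + c) = a * b + a * c := by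
  ext τ; simp [coeff_mul, mul_add, sum_add_distrib]

/-- `(τ \ ρ) \ (σ \ ρ) = τ \ σ` for `ρ ⊆ σ`. [folklore] -/
private theorem sdiff_sdiff_sdiff_of_subset {ρ σ τ : Finset ι} (h : ρ ⊆ σ) :
    (τ \ ρ) \ (σ \ ρ) = τ \ σ := by
  ext x
  simp only [mem_sdiff]
  constructor
  · rintro ⟨⟨hxτ, hxρ⟩, h2⟩
    exact ⟨hxτ, fun hxσ => h2 ⟨hxσ, hxρ⟩⟩
  · rintro ⟨hxτ, hxσ⟩
    exact ⟨⟨hxτ, fun hxρ => hxσ (h hxρ)⟩, fun h2 => hxσ h2.1⟩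

/-- Associativity of the convolution product. [folklore] -/
protected theorem mul_assoc' (a b c : SqFree ι R) : a * b * c = a * (b * c) := by
  ext τ
  simp only [coeff_mul, sum_mul, mul_sum]
  rw [Finset.sum_sigma', Finset.sum_sigma']
  refine Finset.sum_nbij' (fun p => ⟨p.2, p.1 \ p.2⟩) (fun q => ⟨q.1 ∪ q.2, q.1⟩) ?_ ?_ ?_ ?_ ?_
  · rintro ⟨σ, ρ⟩ hp
    simp only [mem_sigma, mem_powerset] at hp ⊢
    exact ⟨hp.2.trans hp.1, sdiff_subset_sdiff hp.1 le_rfl⟩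
  · rintro ⟨ρ, π⟩ hq
    simp only [mem_sigma, mem_powerset] at hq ⊢
    refine ⟨union_subset hq.1 ((hq.2.trans sdiff_subset)), subset_union_left⟩
  · rintro ⟨σ, ρ⟩ hp
    simp only [mem_sigma, mem_powerset] at hp
    simp only [union_sdiff_of_subset hp.2]
  · rintro ⟨ρ, π⟩ hq
    simp only [mem_sigma, mem_powerset] at hq
    have hd : Disjoint ρ π := disjoint_of_subset_right hq.2 disjoint_sdiff
    simp only [union_sdiff_left, sdiff_eq_self_of_disjoint hd.symm]
  · rintro ⟨σ, ρ⟩ hp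
    simp only [mem_sigma, mem_powerset] at hp
    simp only [sdiff_sdiff_sdiff_of_subset hp.2, mul_assoc]

/-- The square-free algebra is a commutative ring. [folklore] -/
instance : CommRing (SqFree ι R) :=
  { (inferInstance : AddCommGroup (SqFree ι R)) with
    mul := (· * ·)
    one := 1
    mul_assoc := SqFree.mul_assoc'
    one_mul := SqFree.one_mul'
    mul_one := fun a => by rw [SqFree.mul_comm', SqFree.one_mul']
    zero_mul := SqFree.zero_mul'
    mul_zero := fun a => by rw [SqFree.mul_comm', SqFree.zero_mul']
    left_distrib := SqFree.left_distrib'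
    right_distrib := fun a b c => by
      rw [SqFree.mul_comm', SqFree.left_distrib', SqFree.mul_comm' c a, SqFree.mul_comm' c b]
    mul_comm := SqFree.mul_comm' }

/-- Coefficients of a finite sum. [folklore] -/
@[simp] private theorem coeff_sum {β : Type*} (s : Finset β) (g : β → SqFree ι R) (τ : Finset ι) :
    (∑ x ∈ s, g x).coeff τ = ∑ x ∈ s, (g x).coeff τ := by
  induction s using Finset.cons_induction with
  | empty => simp
  | cons x s hx ih => rw [sum_cons, sum_cons, coeff_add, ih]

/-- Coefficients of a natural number cast. [folklore] -/
private theorem coeff_natCast (n : ℕ) (τ : Finset ι) :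
    (n : SqFree ι R).coeff τ = if τ = ∅ then (n : R) else 0 := by
  induction n with
  | zero => simp
  | succ n ih =>
    rw [Nat.cast_succ, coeff_add, ih, coeff_one]
    split_ifs <;> simp

/-! ### Monomials, constants -/

/-- The monomial `r · t^σ`. [folklore] -/
def single (σ : Finset ι) (r : R) : SqFree ι R := ⟨fun τ => if τ = σ then r else 0⟩

/-- Coefficients of a monomial. [folklore] -/
private theorem coeff_single (σ : Finset ι) (r : R) (τ : Finset ι) :
    (single σ r).coeff τ = if τ = σ then r else 0 := rfl

/-- The coefficient of a monomial at its own index set. [folklore] -/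
@[simp] private theorem coeff_single_self (σ : Finset ι) (r : R) : (single σ r).coeff σ = r := by
  simp [coeff_single]

/-- A monomial has no other coefficients. [folklore] -/
private theorem coeff_single_of_ne {σ τ : Finset ι} (h : τ ≠ σ) (r : R) : (single σ r).coeff τ = 0 := by
  simp [coeff_single, h]

/-- The zero monomial. [folklore] -/
@[simp] private theorem single_zero (σ : Finset ι) : single σ (0 : R) = 0 := by
  ext τ; simp [coeff_single]

/-- Monomials are additive in the coefficient. [folklore] -/
private theorem single_add (σ : Finset ι) (r s : R) : single σ (r + s) = single σ r + single σ s := by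
  ext τ; simp only [coeff_single, coeff_add]; split_ifs <;> simp

/-- Coefficients of a monomial times an element. [folklore] -/
private theorem coeff_single_mul (σ : Finset ι) (r : R) (a : SqFree ι R) (τ : Finset ι) :
    (single σ r * a).coeff τ = if σ ⊆ τ then r * a.coeff (τ \ σ) else 0 := by
  rw [coeff_mul]
  simp only [coeff_single, ite_mul, zero_mul]
  rw [Finset.sum_ite_eq' (τ.powerset) σ (fun x => r * a.coeff (τ \ x))]
  simp only [mem_powerset]

/-- Product of two monomials. [folklore] -/
private theorem single_mul_single (σ σ' : Finset ι) (r r' : R) :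
    single σ r * single σ' r' = if Disjoint σ σ' then single (σ ∪ σ') (r * r') else 0 := by
  ext τ
  rw [coeff_single_mul]
  split_ifs with h1 h2 h2
  · simp only [coeff_single]
    by_cases h3 : τ = σ ∪ σ'
    · subst h3
      simp [union_sdiff_left, sdiff_eq_self_of_disjoint h2.symm]
    · rw [if_neg, if_neg h3, mul_zero]
      intro h4
      apply h3
      rw [← h4, union_sdiff_of_subset h1]
  · simp only [coeff_single, coeff_zero]
    rw [if_neg, mul_zero]
    intro h4
    apply h2
    rw [← h4]
    exact disjoint_sdiff
  · simp only [coeff_single]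
    rw [if_neg]
    intro h3
    apply h1
    rw [h3]; exact subset_union_left
  · simp

/-- Product of monomials with disjoint index sets. [folklore] -/
private theorem single_mul_single_of_disjoint {σ σ' : Finset ι} (h : Disjoint σ σ') (r r' : R) :
    single σ r * single σ' r' = single (σ ∪ σ') (r * r') := by
  rw [single_mul_single, if_pos h]

/-- Monomials sharing a variable multiply to zero (`t_i² = 0`). [folklore] -/
private theorem single_mul_single_of_not_disjoint {σ σ' : Finset ι} (h : ¬ Disjoint σ σ') (r r' : R) :
    single σ r * single σ' r' = 0 := by
  rw [single_mul_single, if_neg h]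

/-- `t_i² = 0`: a monomial with a nonempty index set squares to zero. [folklore] -/
private theorem single_mul_single_self {σ : Finset ι} (hσ : σ.Nonempty) (r r' : R) :
    single σ r * single σ r' = 0 :=
  single_mul_single_of_not_disjoint (fun h => hσ.ne_empty (disjoint_self.1 h)) r r'

/-- The constants `R → R[t]/(t²)`. [folklore] -/
def C : R →+* SqFree ι R where
  toFun r := single ∅ r
  map_one' := by ext τ; simp [coeff_single, coeff_one]
  map_mul' r s := by
    rw [single_mul_single_of_disjoint (disjoint_empty_left _), union_empty]
  map_zero' := single_zero ∅
  map_add' r s := single_add ∅ r s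

/-- The constant embedding is the empty monomial. [folklore] -/
private theorem C_apply (r : R) : (C r : SqFree ι R) = single ∅ r := rfl

/-- Coefficients of a constant. [folklore] -/
private theorem coeff_C (r : R) (τ : Finset ι) : (C r : SqFree ι R).coeff τ = if τ = ∅ then r else 0 := rfl

/-- Coefficients of a constant multiple. [folklore] -/
@[simp] private theorem coeff_C_mul (r : R) (a : SqFree ι R) (τ : Finset ι) :
    (C r * a).coeff τ = r * a.coeff τ := by
  rw [C_apply, coeff_single_mul]; simp

/-- A constant times a monomial. [folklore] -/
private theorem C_mul_single (r : R) (σ : Finset ι) (s : R) : C r * single σ s = single σ (r * s) := by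
  rw [C_apply, single_mul_single_of_disjoint (disjoint_empty_left _), empty_union]

/-- A monomial as a constant times the unit monomial. [folklore] -/
private theorem single_eq_C_mul (σ : Finset ι) (r : R) : single σ r = C r * single σ 1 := by
  rw [C_mul_single, mul_one]

/-! ### Nilpotency: elements without constant term -/

/-- `a` has no monomials of degree `< k`. [folklore] -/
private def Vanish (k : ℕ) (a : SqFree ι R) : Prop := ∀ τ : Finset ι, τ.card < k → a.coeff τ = 0

/-- `a` has zero constant term (lies in the augmentation ideal). [cite: Sahi2008, Thm. 1 (p. 210)] -/
def IsNil (a : SqFree ι R) : Prop := a.coeff ∅ = 0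

omit [DecidableEq ι] in
/-- No constant term iff no monomials of degree `< 1`. [folklore] -/
private theorem isNil_iff_vanish_one (a : SqFree ι R) : a.IsNil ↔ a.Vanish 1 := by
  constructor
  · intro h τ hτ
    rw [Nat.lt_one_iff, card_eq_zero] at hτ
    rw [hτ]; exact h
  · intro h; exact h ∅ (by simp)

omit [DecidableEq ι] in
/-- Monotonicity of the vanishing order. [folklore] -/
private theorem Vanish.mono {j k : ℕ} (hjk : j ≤ k) {a : SqFree ι R} (h : a.Vanish k) : a.Vanish j :=
  fun τ hτ => h τ (lt_of_lt_of_le hτ hjk)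

omit [DecidableEq ι] in
/-- Every element vanishes below degree `0`. [folklore] -/
private theorem vanish_zero (a : SqFree ι R) : a.Vanish 0 := fun _ h => (Nat.not_lt_zero _ h).elim

/-- Closure under products. [folklore] -/
private theorem Vanish.mul {j k : ℕ} {a b : SqFree ι R} (ha : a.Vanish j) (hb : b.Vanish k) :
    (a * b).Vanish (j + k) := by
  intro τ hτ
  rw [coeff_mul]
  refine Finset.sum_eq_zero fun σ hσ => ?_
  have hστ := mem_powerset.1 hσ
  have hcard : (τ \ σ).card + σ.card = τ.card := card_sdiff_add_card_eq_card hστ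
  by_cases h1 : σ.card < j
  · rw [ha σ h1, zero_mul]
  · have h2 : (τ \ σ).card < k := by omega
    rw [hb _ h2, mul_zero]

/-- Closure under products (left factor). [folklore] -/
private theorem Vanish.mul_left {k : ℕ} {a : SqFree ι R} (ha : a.Vanish k) (b : SqFree ι R) :
    (a * b).Vanish k := by
  simpa using ha.mul (vanish_zero b)

/-- Closure under products (right factor). [folklore] -/
private theorem Vanish.mul_right {k : ℕ} {b : SqFree ι R} (hb : b.Vanish k) (a : SqFree ι R) :
    (a * b).Vanish k := by
  simpa using (vanish_zero a).mul hb

/-- Closure under powers. [folklore] -/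
private theorem Vanish.pow {a : SqFree ι R} (ha : a.Vanish 1) (k : ℕ) : (a ^ k).Vanish k := by
  induction k with
  | zero => exact vanish_zero _
  | succ k ih => rw [pow_succ]; exact ih.mul ha

omit [DecidableEq ι] in
/-- Closure under addition. [folklore] -/
private theorem Vanish.add {k : ℕ} {a b : SqFree ι R} (ha : a.Vanish k) (hb : b.Vanish k) :
    (a + b).Vanish k := fun τ hτ => by rw [coeff_add, ha τ hτ, hb τ hτ, add_zero]

omit [DecidableEq ι] in
/-- Closure under negation. [folklore] -/
private theorem Vanish.neg {k : ℕ} {a : SqFree ι R} (ha : a.Vanish k) : (-a).Vanish k :=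
  fun τ hτ => by rw [coeff_neg, ha τ hτ, neg_zero]

omit [DecidableEq ι] in
/-- An element vanishing below degree `n + 1` in `n` variables is zero. [folklore] -/
private theorem eq_zero_of_vanish [Fintype ι] {a : SqFree ι R} (h : a.Vanish (Fintype.card ι + 1)) :
    a = 0 := by
  ext τ
  exact h τ (Nat.lt_succ_of_le (card_le_univ τ))

/-- In `n` variables, a product of elements without constant term having more than `n`
factors (counted with the degrees `j`, `k`) vanishes. [folklore] -/
private theorem mul_eq_zero_of_vanish [Fintype ι] {j k : ℕ} {a b : SqFree ι R} (ha : a.Vanish j)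
    (hb : b.Vanish k) (hjk : Fintype.card ι < j + k) : a * b = 0 :=
  eq_zero_of_vanish ((ha.mul hb).mono hjk)

namespace IsNil

omit [DecidableEq ι] in
/-- An element without constant term vanishes below degree `1`. [folklore] -/
private theorem vanish {a : SqFree ι R} (h : a.IsNil) : a.Vanish 1 := (isNil_iff_vanish_one a).1 h

omit [DecidableEq ι] in
/-- The zero case. [folklore] -/
private theorem zero : (0 : SqFree ι R).IsNil := rfl

omit [DecidableEq ι] in
/-- Closure under addition. [folklore] -/
private theorem add {a b : SqFree ι R} (ha : a.IsNil) (hb : b.IsNil) : (a + b).IsNil := by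
  unfold IsNil at *; rw [coeff_add, ha, hb, add_zero]

omit [DecidableEq ι] in
/-- Closure under negation. [folklore] -/
private theorem neg {a : SqFree ι R} (ha : a.IsNil) : (-a).IsNil := by
  unfold IsNil at *; rw [coeff_neg, ha, neg_zero]

omit [DecidableEq ι] in
/-- Closure under subtraction. [folklore] -/
private theorem sub {a b : SqFree ι R} (ha : a.IsNil) (hb : b.IsNil) : (a - b).IsNil := by
  unfold IsNil at *; rw [coeff_sub, ha, hb, sub_zero]

/-- Closure under products (left factor). [folklore] -/
private theorem mul_left {a : SqFree ι R} (ha : a.IsNil) (b : SqFree ι R) : (a * b).IsNil :=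
  (isNil_iff_vanish_one _).2 (ha.vanish.mul_left b)

/-- Closure under products (right factor). [folklore] -/
private theorem mul_right {b : SqFree ι R} (hb : b.IsNil) (a : SqFree ι R) : (a * b).IsNil :=
  (isNil_iff_vanish_one _).2 (hb.vanish.mul_right a)

/-- Closure under finite sums. [folklore] -/
private theorem sum {β : Type*} {s : Finset β} {g : β → SqFree ι R} (h : ∀ x ∈ s, (g x).IsNil) :
    (∑ x ∈ s, g x).IsNil := by
  unfold IsNil at *
  rw [coeff_sum]
  exact Finset.sum_eq_zero h

/-- Positive powers of an element without constant term have no constant term. [folklore] -/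
private theorem pow_succ {a : SqFree ι R} (ha : a.IsNil) (k : ℕ) : (a ^ (k + 1)).IsNil := by
  rw [_root_.pow_succ]; exact ha.mul_right _

/-- Constant term of a power of an element without constant term. [folklore] -/
private theorem coeff_pow_empty {a : SqFree ι R} (ha : a.IsNil) (k : ℕ) :
    (a ^ k).coeff ∅ = if k = 0 then 1 else 0 := by
  cases k with
  | zero => simp [coeff_one]
  | succ k => rw [if_neg (Nat.succ_ne_zero k)]; exact ha.pow_succ k

/-- `u^{n+1} = 0` in `n` variables when `u` has no constant term. [folklore] -/
private theorem pow_card_succ [Fintype ι] {a : SqFree ι R} (ha : a.IsNil) :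
    a ^ (Fintype.card ι + 1) = 0 :=
  eq_zero_of_vanish (ha.vanish.pow _)

/-- High powers of an element without constant term vanish. [folklore] -/
private theorem pow_eq_zero_of_lt [Fintype ι] {a : SqFree ι R} (ha : a.IsNil) {k : ℕ}
    (hk : Fintype.card ι < k) : a ^ k = 0 :=
  eq_zero_of_vanish ((ha.vanish.pow k).mono hk)

end IsNil

/-- A monomial with nonempty index set has no constant term. [folklore] -/
private theorem isNil_single {σ : Finset ι} (hσ : σ.Nonempty) (r : R) : (single σ r).IsNil := by
  unfold IsNil; rw [coeff_single, if_neg]; exact (nonempty_iff_ne_empty.1 hσ).symm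

/-- Constant term of a constant multiple. [folklore] -/
private theorem coeff_empty_C_mul (r : R) (a : SqFree ι R) : (C r * a).coeff ∅ = r * a.coeff ∅ :=
  coeff_C_mul r a ∅

/-! ### Change of coefficients -/

/-- Coefficientwise action of a ring homomorphism. [folklore] -/
def map {S : Type*} [CommRing S] (φ : R →+* S) : SqFree ι R →+* SqFree ι S where
  toFun a := ⟨fun τ => φ (a.coeff τ)⟩
  map_one' := by
    ext τ; simp only [coeff_one]; split_ifs <;> simp
  map_mul' a b := by
    ext τ; simp only [coeff_mul, map_sum, map_mul]
  map_zero' := by ext τ; simp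
  map_add' a b := by ext τ; simp

/-- Coefficients after a change of coefficient ring. [folklore] -/
@[simp] private theorem coeff_map {S : Type*} [CommRing S] (φ : R →+* S) (a : SqFree ι R) (τ : Finset ι) :
    (map φ a).coeff τ = φ (a.coeff τ) := rfl

/-- Change of coefficients on a monomial. [folklore] -/
private theorem map_single {S : Type*} [CommRing S] (φ : R →+* S) (σ : Finset ι) (r : R) :
    map φ (single σ r) = single σ (φ r) := by
  refine SqFree.ext fun τ => ?_
  rw [coeff_map, coeff_single, coeff_single]
  split_ifs
  · rfl
  · exact map_zero φ

/-- Change of coefficients on a constant. [folklore] -/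
private theorem map_C {S : Type*} [CommRing S] (φ : R →+* S) (r : R) :
    map φ (C r : SqFree ι R) = C (φ r) := map_single φ ∅ r

/-- Functoriality of the change of coefficients. [folklore] -/
private theorem map_map {S T : Type*} [CommRing S] [CommRing T] (φ : R →+* S) (ψ : S →+* T)
    (a : SqFree ι R) : map ψ (map φ a) = map (ψ.comp φ) a := rfl

/-- Change of coefficients along the identity. [folklore] -/
private theorem map_id (a : SqFree ι R) : map (RingHom.id R) a = a := rfl

/-- Change of coefficients preserves having no constant term. [folklore] -/
private theorem IsNil.map {S : Type*} [CommRing S] (φ : R →+* S) {a : SqFree ι R} (ha : a.IsNil) :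
    (map φ a).IsNil := by
  unfold IsNil at *; rw [coeff_map, ha, map_zero]

/-- **Polynomial identity principle.**  Two elements of the square-free algebra over `ℝ[X]`
that agree after evaluating `X` at every natural number are equal. [folklore] -/
private theorem eq_of_forall_eval_natCast {a b : SqFree ι (Polynomial ℝ)}
    (h : ∀ k : ℕ, map (Polynomial.evalRingHom (k : ℝ)) a = map (Polynomial.evalRingHom (k : ℝ)) b) :
    a = b := by
  refine SqFree.ext fun τ => ?_
  rw [← sub_eq_zero]
  apply Polynomial.eq_zero_of_infinite_isRoot
  refine Set.infinite_of_injective_forall_mem (f := fun k : ℕ => (k : ℝ)) Nat.cast_injective ?_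
  intro k
  have hk := congrArg (fun z => z.coeff τ) (h k)
  simp only [coeff_map, Polynomial.coe_evalRingHom] at hk
  simp only [Set.mem_setOf_eq, Polynomial.IsRoot.def, Polynomial.eval_sub, hk, sub_self]

/-- Evaluating constant polynomial coefficients gives back the element. [folklore] -/
private theorem map_evalRingHom_map_C (x : ℝ) (a : SqFree ι ℝ) :
    map (Polynomial.evalRingHom x) (map Polynomial.C a) = a := by
  refine SqFree.ext fun τ => ?_
  simp [coeff_map]

/-! ### The degree derivation `D(t^τ) = |τ|·t^τ` -/

/-- The Euler/degree derivation `D(t^τ) = |τ| t^τ`. [folklore] -/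
def D (a : SqFree ι R) : SqFree ι R := ⟨fun τ => (τ.card : R) * a.coeff τ⟩

omit [DecidableEq ι] in
/-- Coefficients of the degree derivation. [folklore] -/
@[simp] private theorem coeff_D (a : SqFree ι R) (τ : Finset ι) :
    (D a).coeff τ = (τ.card : R) * a.coeff τ := rfl

omit [DecidableEq ι] in
/-- `D` is additive. [folklore] -/
private theorem D_add (a b : SqFree ι R) : D (a + b) = D a + D b := by
  ext τ; simp [mul_add]

omit [DecidableEq ι] in
/-- `D` commutes with negation. [folklore] -/
private theorem D_neg (a : SqFree ι R) : D (-a) = -D a := by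
  ext τ; simp

omit [DecidableEq ι] in
/-- `D` commutes with subtraction. [folklore] -/
private theorem D_sub (a b : SqFree ι R) : D (a - b) = D a - D b := by
  ext τ; simp [mul_sub]

/-- `D` commutes with finite sums. [folklore] -/
private theorem D_sum {β : Type*} (s : Finset β) (g : β → SqFree ι R) :
    D (∑ x ∈ s, g x) = ∑ x ∈ s, D (g x) := by
  ext τ; simp [mul_sum]

/-- `D 1 = 0`. [folklore] -/
private theorem D_one : D (1 : SqFree ι R) = 0 := by
  ext τ; simp only [coeff_D, coeff_one, coeff_zero]; split_ifs with h <;> simp [h]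

/-- `D` kills constants. [folklore] -/
private theorem D_C (r : R) : D (C r : SqFree ι R) = 0 := by
  ext τ; simp only [coeff_D, coeff_C, coeff_zero]; split_ifs with h <;> simp [h]

/-- `D` on a monomial multiplies by its degree. [folklore] -/
private theorem D_single (σ : Finset ι) (r : R) : D (single σ r) = C (σ.card : R) * single σ r := by
  ext τ; simp only [coeff_D, coeff_single, coeff_C_mul]; split_ifs with h <;> simp [h]

/-- Leibniz rule. [folklore] -/
private theorem D_mul (a b : SqFree ι R) : D (a * b) = D a * b + a * D b := by
  ext τ
  simp only [coeff_D, coeff_mul, coeff_add, mul_sum, ← sum_add_distrib]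
  refine Finset.sum_congr rfl fun σ hσ => ?_
  have h := card_sdiff_add_card_eq_card (mem_powerset.1 hσ)
  have h' : (τ.card : R) = ((τ \ σ).card : R) + (σ.card : R) := by
    rw [← h]; push_cast; ring
  rw [h']; ring

/-- `D (a^{k+1}) = (k+1) a^k D a`. [folklore] -/
private theorem D_pow (a : SqFree ι R) (k : ℕ) : D (a ^ (k + 1)) = C ((k : R) + 1) * (a ^ k * D a) := by
  induction k with
  | zero => simp
  | succ k ih =>
    rw [pow_succ, D_mul, ih, pow_succ]
    push_cast
    simp only [map_add, map_one]
    ring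

/-- `D` is `C`-linear. [folklore] -/
private theorem D_C_mul (r : R) (a : SqFree ι R) : D (C r * a) = C r * D a := by
  rw [D_mul, D_C, zero_mul, zero_add]

omit [DecidableEq ι] in
/-- `D a` has no constant term. [folklore] -/
private theorem isNil_D (a : SqFree ι R) : (D a).IsNil := by
  simp [IsNil]

/-- Leibniz rule for finite products. [folklore] -/
private theorem D_prod {β : Type*} [DecidableEq β] (s : Finset β) (g : β → SqFree ι R) :
    D (∏ x ∈ s, g x) = ∑ x ∈ s, (∏ y ∈ s.erase x, g y) * D (g x) := by
  induction s using Finset.induction_on with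
  | empty => simp [D_one]
  | insert x s hx ih =>
    rw [prod_insert hx, D_mul, ih, sum_insert hx, erase_insert hx, mul_sum]
    congr 1
    · ring
    · refine Finset.sum_congr rfl fun y hy => ?_
      have hxy : x ≠ y := fun h => hx (h ▸ hy)
      rw [erase_insert_of_ne hxy, prod_insert (fun h => hx (mem_of_mem_erase h))]
      ring

/-- `∏ (A_x (1 - w_x)) = (∏ A_x)(1 - Σ w_x)` when all products `w_x w_y` vanish. [folklore] -/
private theorem prod_mul_one_sub {β : Type*} (s : Finset β) (A w : β → SqFree ι R)
    (hw : ∀ x ∈ s, ∀ y ∈ s, w x * w y = 0) :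
    ∏ x ∈ s, (A x * (1 - w x)) = (∏ x ∈ s, A x) * (1 - ∑ x ∈ s, w x) := by
  induction s using Finset.cons_induction with
  | empty => simp
  | cons x s hx ih =>
    rw [prod_cons, prod_cons, sum_cons,
      ih (fun y hy z hz => hw y (mem_cons_of_mem hy) z (mem_cons_of_mem hz))]
    have h0 : w x * ∑ y ∈ s, w y = 0 := by
      rw [mul_sum]
      exact Finset.sum_eq_zero fun y hy => hw x (mem_cons_self x s) y (mem_cons_of_mem hy)
    have : (1 - w x) * (1 - ∑ y ∈ s, w y) = 1 - (w x + ∑ y ∈ s, w y) := by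
      rw [sub_mul, one_mul, mul_sub, mul_one, h0, sub_zero]; ring
    rw [← this]; ring

/-- `(u + w)^{k+1} = u^{k+1} + (k+1) u^k w` when `w² = 0`. [folklore] -/
private theorem add_pow_succ_of_mul_self_eq_zero {u w : SqFree ι R} (hww : w * w = 0) (k : ℕ) :
    (u + w) ^ (k + 1) = u ^ (k + 1) + C ((k : R) + 1) * (u ^ k * w) := by
  induction k with
  | zero => simp
  | succ k ih =>
    rw [pow_succ, ih]
    have h0 : C ((k : R) + 1) * (u ^ k * w) * w = 0 := by
      rw [mul_assoc, mul_assoc, hww, mul_zero, mul_zero]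
    have e : (C ((↑(k + 1) : R) + 1) : SqFree ι R) = C ((k : R) + 1) + 1 := by
      push_cast; rw [map_add, map_one]
    rw [e]
    linear_combination h0

end SqFree

/-! ## Part B.  Generalised binomial coefficients and the binomial powers `(1 - u)^c` -/

section RCh

open Polynomial

variable {R : Type*} [CommRing R] [Algebra ℚ R]

/-- The generalised binomial coefficient `C(c, k) = c(c-1)⋯(c-k+1)/k!` in a `ℚ`-algebra.
[folklore] -/
noncomputable def rch (k : ℕ) (c : R) : R :=
  algebraMap ℚ R ((k.factorial : ℚ)⁻¹) * (descPochhammer R k).eval c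

/-- `C(c, 0) = 1`. [folklore] -/
private theorem rch_zero (c : R) : rch 0 c = 1 := by simp [rch]

/-- `C(c, 1) = c`. [folklore] -/
private theorem rch_one (c : R) : rch 1 c = c := by simp [rch]

/-- `C(0, k) = 0` for `k ≥ 1`. [folklore] -/
private theorem rch_at_zero_of_ne_zero {k : ℕ} (hk : k ≠ 0) : rch k (0 : R) = 0 := by
  rw [rch, descPochhammer_ne_zero_eval_zero R hk, mul_zero]

omit [Algebra ℚ R] in
/-- `c(c-1)⋯(c-k) = c · ((c-1)⋯(c-k))`. [folklore] -/
private theorem descPochhammer_eval_succ_left' (k : ℕ) (c : R) :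
    (descPochhammer R (k + 1)).eval c = c * (descPochhammer R k).eval (c - 1) := by
  rw [descPochhammer_succ_left, eval_mul, eval_X, eval_comp, eval_sub, eval_X, eval_one]

/-- `(k+1)!⁻¹ (k+1) = k!⁻¹`. [folklore] -/
private theorem algebraMap_factorial_succ_inv_mul (k : ℕ) :
    algebraMap ℚ R (((k + 1).factorial : ℚ)⁻¹) * ((k : R) + 1) =
      algebraMap ℚ R ((k.factorial : ℚ)⁻¹) := by
  have h : ((k : R) + 1) = algebraMap ℚ R ((k : ℚ) + 1) := by simp
  rw [h, ← map_mul]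
  congr 1
  have h1 : ((k : ℚ) + 1) ≠ 0 := by positivity
  have h2 : ((k.factorial : ℕ) : ℚ) ≠ 0 := by positivity
  rw [Nat.factorial_succ]
  push_cast
  field_simp

/-- `k!⁻¹ · k! = 1`. [folklore] -/
private theorem algebraMap_factorial_inv_mul (k : ℕ) :
    algebraMap ℚ R ((k.factorial : ℚ)⁻¹) * (k.factorial : R) = 1 := by
  have h : (k.factorial : R) = algebraMap ℚ R (k.factorial : ℚ) := by simp
  rw [h, ← map_mul]
  have h2 : ((k.factorial : ℕ) : ℚ) ≠ 0 := by positivity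
  rw [inv_mul_cancel₀ h2, map_one]

/-- Pascal's rule `C(c, k+1) = C(c-1, k+1) + C(c-1, k)`. [folklore] -/
private theorem rch_succ_pascal (k : ℕ) (c : R) : rch (k + 1) c = rch (k + 1) (c - 1) + rch k (c - 1) := by
  simp only [rch]
  rw [descPochhammer_eval_succ_left', descPochhammer_succ_eval, ← algebraMap_factorial_succ_inv_mul k]
  ring

/-- `(k+1)·C(c, k+1) = c·C(c-1, k)`. [folklore] -/
private theorem succ_mul_rch_succ (k : ℕ) (c : R) : ((k : R) + 1) * rch (k + 1) c = c * rch k (c - 1) := by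
  simp only [rch]
  rw [descPochhammer_eval_succ_left', ← algebraMap_factorial_succ_inv_mul k]
  ring

/-- At natural arguments `C(n,k)` is the usual binomial coefficient. [folklore] -/
private theorem rch_natCast (k n : ℕ) : rch k (n : R) = ((n.choose k : ℕ) : R) := by
  simp only [rch]
  rw [descPochhammer_eval_eq_descFactorial, Nat.descFactorial_eq_factorial_mul_choose, Nat.cast_mul,
    ← mul_assoc, algebraMap_factorial_inv_mul, one_mul]

/-- Ring homomorphisms of `ℚ`-algebras preserve the generalised binomial coefficients. [folklore] -/
private theorem map_rch {S : Type*} [CommRing S] [Algebra ℚ S] (φ : R →+* S) (k : ℕ) (c : R) :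
    φ (rch k c) = rch k (φ c) := by
  simp only [rch, map_mul, RingHom.map_rat_algebraMap]
  rw [← Polynomial.eval₂_hom, ← Polynomial.eval_map, descPochhammer_map]

/-- Real generalised binomial coefficient as a quotient. [folklore] -/
private theorem rch_real (k : ℕ) (c : ℝ) : rch k c = (descPochhammer ℝ k).eval c / k.factorial := by
  simp [rch, div_eq_inv_mul]

/-- Recursion `C(m,k+2) = C(m,k+1)(m-k-1)/(k+2)` over `ℝ`. [folklore] -/
private theorem rch_succ_succ_real (k : ℕ) (m : ℝ) :
    rch (k + 2) m = rch (k + 1) m * (m - ((k : ℝ) + 1)) / ((k : ℝ) + 2) := by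
  rw [rch_real, rch_real, descPochhammer_succ_eval, Nat.factorial_succ (k + 1)]
  have h1 : (((k + 1).factorial : ℕ) : ℝ) ≠ 0 := by positivity
  have h2 : ((k : ℝ) + 2) ≠ 0 := by positivity
  push_cast
  field_simp
  ring

/-- For `0 ≤ m ≤ 1` the coefficients `β_k = (-1)^{k-1} C(m, k)`, `k ≥ 1`, are nonnegative.
[cite: Sahi2008, proof of Lemma 16 / Theorem 1 (p. 218): `(-1)^{i-1} C(m_x, i) ≥ 0`] -/
theorem neg_one_pow_mul_rch_succ_nonneg {m : ℝ} (h0 : 0 ≤ m) (h1 : m ≤ 1) (k : ℕ) :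
    0 ≤ (-1 : ℝ) ^ k * rch (k + 1) m := by
  induction k with
  | zero => simpa [rch_one] using h0
  | succ k ih =>
    have e : (-1 : ℝ) ^ (k + 1) * rch (k + 1 + 1) m
        = ((-1) ^ k * rch (k + 1) m) * ((((k : ℝ) + 1) - m) / ((k : ℝ) + 2)) := by
      rw [show k + 1 + 1 = k + 2 from rfl, rch_succ_succ_real]; ring
    rw [e]
    refine mul_nonneg ih (div_nonneg ?_ (by positivity))
    have : (0 : ℝ) ≤ k := Nat.cast_nonneg k
    linarith

end RCh

namespace SqFree

variable {R : Type*} [CommRing R]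
variable {κ : Type*} [DecidableEq κ] [Fintype κ]

/-- The inverse `(1 - u)^{-1} = Σ_j u^j` of `1 - u` for `u` without constant term. [folklore] -/
def inv1 (u : SqFree κ R) : SqFree κ R := ∑ j ∈ range (Fintype.card κ + 1), u ^ j

/-- `(1-u) Σ_j u^j = 1` for `u` without constant term. [folklore] -/
private theorem one_sub_mul_inv1 {u : SqFree κ R} (hu : u.IsNil) : (1 - u) * inv1 u = 1 := by
  rw [inv1, mul_neg_geom_sum, hu.pow_card_succ, sub_zero]

/-- `(Σ_j u^j)(1-u) = 1` for `u` without constant term. [folklore] -/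
private theorem inv1_mul_one_sub {u : SqFree κ R} (hu : u.IsNil) : inv1 u * (1 - u) = 1 := by
  rw [mul_comm, one_sub_mul_inv1 hu]

/-- `u (1-u)⁻¹ = (1-u)⁻¹ - 1`. [folklore] -/
private theorem mul_inv1 {u : SqFree κ R} (hu : u.IsNil) : u * inv1 u = inv1 u - 1 := by
  have h := one_sub_mul_inv1 hu
  rw [sub_mul, one_mul] at h
  linear_combination -h

/-- Change of coefficients commutes with `(1-u)⁻¹`. [folklore] -/
private theorem map_inv1 {S : Type*} [CommRing S] (φ : R →+* S) (u : SqFree κ R) :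
    map φ (inv1 u) = inv1 (map φ u) := by
  simp [inv1, map_sum, map_pow]

variable [Algebra ℚ R]

/-- The binomial power `(1 - u)^c := Σ_k C(c,k) (-u)^k` of an element `u` without constant term
(the sum is finite: `u^{n+1} = 0`).  [cite: Sahi2008, eq. (12) and the expansion on p. 218] -/
noncomputable def binomB (c : R) (u : SqFree κ R) : SqFree κ R :=
  ∑ k ∈ range (Fintype.card κ + 1), C (rch k c) * (-u) ^ k

/-- A binomial power has constant term `1`. [folklore] -/
private theorem coeff_empty_binomB {u : SqFree κ R} (hu : u.IsNil) (c : R) : (binomB c u).coeff ∅ = 1 := by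
  rw [binomB, coeff_sum]
  have : ∀ k ∈ range (Fintype.card κ + 1),
      (C (rch k c) * (-u) ^ k).coeff ∅ = if k = 0 then rch k c else 0 := by
    intro k _
    rw [coeff_C_mul, hu.neg.coeff_pow_empty]
    split_ifs <;> simp
  rw [Finset.sum_congr rfl this, Finset.sum_ite_eq']
  simp [rch_zero]

/-- `1 - (1-u)^c` has no constant term. [folklore] -/
private theorem isNil_one_sub_binomB {u : SqFree κ R} (hu : u.IsNil) (c : R) : (1 - binomB c u).IsNil := by
  unfold IsNil
  rw [coeff_sub, coeff_one, if_pos rfl, coeff_empty_binomB hu, sub_self]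

/-- Change of coefficients commutes with binomial powers. [folklore] -/
private theorem map_binomB {S : Type*} [CommRing S] [Algebra ℚ S] (φ : R →+* S) (c : R) (u : SqFree κ R) :
    map φ (binomB c u) = binomB (φ c) (map φ u) := by
  simp [binomB, map_sum, map_mul, map_pow, map_neg, SqFree.map_C, map_rch]

/-- `(1-u)^0 = 1`. [folklore] -/
private theorem binomB_zero_left (u : SqFree κ R) : binomB (0 : R) u = 1 := by
  rw [binomB, Finset.sum_range_succ']
  have : ∀ k ∈ range (Fintype.card κ), C (rch (k + 1) (0 : R)) * (-u) ^ (k + 1) = 0 := by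
    intro k _
    rw [rch_at_zero_of_ne_zero (Nat.succ_ne_zero k), map_zero, zero_mul]
  rw [Finset.sum_eq_zero this]
  simp [rch_zero]

/-- Pascal's rule for binomial powers: `(1-u)^c = (1-u)^{c-1} (1-u)`. [folklore] -/
private theorem binomB_pascal {u : SqFree κ R} (hu : u.IsNil) (c : R) :
    binomB c u = binomB (c - 1) u * (1 - u) := by
  have hpow : (-u) ^ (Fintype.card κ + 1) = 0 := hu.neg.pow_card_succ
  have eR : binomB (c - 1) u * (1 - u)
      = binomB (c - 1) u + ∑ k ∈ range (Fintype.card κ), C (rch k (c - 1)) * (-u) ^ (k + 1) := by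
    have : (1 : SqFree κ R) - u = 1 + (-u) := sub_eq_add_neg 1 u
    rw [this, mul_add, mul_one]
    congr 1
    rw [binomB, Finset.sum_mul, Finset.sum_range_succ]
    have hl : C (rch (Fintype.card κ) (c - 1)) * (-u) ^ (Fintype.card κ) * (-u) = 0 := by
      rw [mul_assoc, ← pow_succ, hpow, mul_zero]
    rw [hl, add_zero]
    refine Finset.sum_congr rfl fun k _ => ?_
    rw [mul_assoc, ← pow_succ]
  rw [eR, binomB, binomB, Finset.sum_range_succ' (fun k => C (rch k c) * (-u) ^ k),
    Finset.sum_range_succ' (fun k => C (rch k (c - 1)) * (-u) ^ k)]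
  simp only [rch_zero, pow_zero, mul_one, rch_succ_pascal _ c, map_add, add_mul, Finset.sum_add_distrib]
  ring

/-- For natural exponents the binomial power is the ordinary power. [folklore] -/
private theorem binomB_natCast {u : SqFree κ R} (hu : u.IsNil) (k : ℕ) : binomB (k : R) u = (1 - u) ^ k := by
  induction k with
  | zero => rw [Nat.cast_zero, binomB_zero_left u, pow_zero]
  | succ k ih =>
    rw [binomB_pascal hu, Nat.cast_succ, add_sub_cancel_right, ih, pow_succ]

/-- `(1-u)^1 = 1 - u`. [folklore] -/
private theorem binomB_one_left {u : SqFree κ R} (hu : u.IsNil) : binomB (1 : R) u = 1 - u := by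
  simpa using binomB_natCast hu 1

/-- `(1-u)^{c+k} = (1-u)^c (1-u)^k` for natural `k`. [folklore] -/
private theorem binomB_add_natCast {u : SqFree κ R} (hu : u.IsNil) (c : R) (k : ℕ) :
    binomB (c + k) u = binomB c u * (1 - u) ^ k := by
  induction k with
  | zero => rw [Nat.cast_zero, add_zero, pow_zero, mul_one]
  | succ k ih =>
    rw [Nat.cast_succ, ← add_assoc, binomB_pascal hu (c + k + 1), add_sub_cancel_right, ih, pow_succ,
      mul_assoc]

/-- `(1-u)^{c-1} = (1-u)^c (1-u)⁻¹`. [folklore] -/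
private theorem binomB_sub_one {u : SqFree κ R} (hu : u.IsNil) (c : R) :
    binomB (c - 1) u = binomB c u * inv1 u := by
  rw [binomB_pascal hu c, mul_assoc, one_sub_mul_inv1 hu, mul_one]

/-- `(1-u)^c = 1 - Σ_{k ≥ 1} β_k u^k`, `β_k = (-1)^{k-1} C(c,k)`. [cite: Sahi2008, p. 218] -/
theorem binomB_eq_one_sub (c : R) (u : SqFree κ R) :
    binomB c u = 1 - ∑ k ∈ range (Fintype.card κ), C ((-1) ^ k * rch (k + 1) c) * u ^ (k + 1) := by
  rw [binomB, Finset.sum_range_succ', rch_zero, map_one, pow_zero, mul_one, add_comm, sub_eq_add_neg,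
    ← Finset.sum_neg_distrib]
  congr 1
  refine Finset.sum_congr rfl fun k _ => ?_
  rw [neg_pow, map_mul, map_pow, map_neg, map_one]
  ring

/-- First-order expansion in a square-zero direction:
`(1 - (u + w))^c = (1-u)^c - c·w·(1-u)^{c-1}` when `w² = 0`. [folklore] -/
private theorem binomB_add_of_mul_self_eq_zero {u w : SqFree κ R} (hu : u.IsNil) (hw : w.IsNil)
    (hww : w * w = 0) (c : R) :
    binomB c (u + w) = binomB c u - C c * w * binomB (c - 1) u := by
  have hnw : (-w) * (-w) = 0 := by rw [neg_mul_neg, hww]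
  have hlast : w * (-u) ^ (Fintype.card κ) = 0 :=
    mul_eq_zero_of_vanish hw.vanish (hu.neg.vanish.pow (Fintype.card κ)) (by omega)
  -- expand the left-hand side
  have eL : binomB c (u + w)
      = binomB c u + ∑ k ∈ range (Fintype.card κ), C (rch (k + 1) c) * (C ((k : R) + 1) * ((-u) ^ k * (-w))) := by
    rw [binomB, binomB, Finset.sum_range_succ' (fun k => C (rch k c) * (-(u + w)) ^ k),
      Finset.sum_range_succ' (fun k => C (rch k c) * (-u) ^ k), neg_add]
    simp only [pow_zero, add_pow_succ_of_mul_self_eq_zero hnw, mul_add, Finset.sum_add_distrib]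
    ring
  -- identify the correction term
  have eS : ∑ k ∈ range (Fintype.card κ), C (rch (k + 1) c) * (C ((k : R) + 1) * ((-u) ^ k * (-w)))
      = -(C c * w * ∑ k ∈ range (Fintype.card κ), C (rch k (c - 1)) * (-u) ^ k) := by
    rw [mul_sum, ← Finset.sum_neg_distrib]
    refine Finset.sum_congr rfl fun k _ => ?_
    have : (C (rch (k + 1) c) : SqFree κ R) * C ((k : R) + 1) = C c * C (rch k (c - 1)) := by
      rw [← map_mul, ← map_mul, mul_comm (rch (k+1) c), succ_mul_rch_succ]
    calc C (rch (k + 1) c) * (C ((k : R) + 1) * ((-u) ^ k * -w))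
        = (C (rch (k + 1) c) * C ((k : R) + 1)) * ((-u) ^ k * -w) := by ring
      _ = C c * C (rch k (c - 1)) * ((-u) ^ k * -w) := by rw [this]
      _ = -(C c * w * (C (rch k (c - 1)) * (-u) ^ k)) := by ring
  have eB : ∑ k ∈ range (Fintype.card κ), C (rch k (c - 1)) * (-u) ^ k
      = binomB (c - 1) u - C (rch (Fintype.card κ) (c - 1)) * (-u) ^ (Fintype.card κ) := by
    rw [binomB, Finset.sum_range_succ]; ring
  rw [eL, eS, eB, mul_sub]
  have : C c * w * (C (rch (Fintype.card κ) (c - 1)) * (-u) ^ (Fintype.card κ)) = 0 := by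
    calc C c * w * (C (rch (Fintype.card κ) (c - 1)) * (-u) ^ (Fintype.card κ)) = C c * C (rch (Fintype.card κ) (c - 1)) * (w * (-u) ^ (Fintype.card κ)) := by ring
      _ = 0 := by rw [hlast, mul_zero]
  rw [this, sub_zero]; ring

/-- Derivative of a binomial power along the degree derivation:
`D (1-u)^c = -c · D u · (1-u)^{c-1}`. [folklore] -/
private theorem D_binomB {u : SqFree κ R} (hu : u.IsNil) (c : R) :
    D (binomB c u) = -(C c * D u * binomB (c - 1) u) := by
  have hlast : D u * (-u) ^ (Fintype.card κ) = 0 :=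
    mul_eq_zero_of_vanish (isNil_D u).vanish (hu.neg.vanish.pow (Fintype.card κ)) (by omega)
  have eL : D (binomB c u)
      = ∑ k ∈ range (Fintype.card κ), C (rch (k + 1) c) * (C ((k : R) + 1) * ((-u) ^ k * -D u)) := by
    rw [binomB, Finset.sum_range_succ' (fun k => C (rch k c) * (-u) ^ k), D_add, D_sum]
    simp only [pow_zero, mul_one, D_C, add_zero, D_C_mul, D_pow, D_neg]
  have eS : ∑ k ∈ range (Fintype.card κ), C (rch (k + 1) c) * (C ((k : R) + 1) * ((-u) ^ k * -D u))
      = -(C c * D u * ∑ k ∈ range (Fintype.card κ), C (rch k (c - 1)) * (-u) ^ k) := by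
    rw [mul_sum, ← Finset.sum_neg_distrib]
    refine Finset.sum_congr rfl fun k _ => ?_
    have : (C (rch (k + 1) c) : SqFree κ R) * C ((k : R) + 1) = C c * C (rch k (c - 1)) := by
      rw [← map_mul, ← map_mul, mul_comm (rch (k+1) c), succ_mul_rch_succ]
    calc C (rch (k + 1) c) * (C ((k : R) + 1) * ((-u) ^ k * -D u))
        = (C (rch (k + 1) c) * C ((k : R) + 1)) * ((-u) ^ k * -D u) := by ring
      _ = C c * C (rch k (c - 1)) * ((-u) ^ k * -D u) := by rw [this]
      _ = -(C c * D u * (C (rch k (c - 1)) * (-u) ^ k)) := by ring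
  have eB : ∑ k ∈ range (Fintype.card κ), C (rch k (c - 1)) * (-u) ^ k
      = binomB (c - 1) u - C (rch (Fintype.card κ) (c - 1)) * (-u) ^ (Fintype.card κ) := by
    rw [binomB, Finset.sum_range_succ]; ring
  rw [eL, eS, eB, mul_sub]
  have : C c * D u * (C (rch (Fintype.card κ) (c - 1)) * (-u) ^ (Fintype.card κ)) = 0 := by
    calc C c * D u * (C (rch (Fintype.card κ) (c - 1)) * (-u) ^ (Fintype.card κ)) = C c * C (rch (Fintype.card κ) (c - 1)) * (D u * (-u) ^ (Fintype.card κ)) := by ring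
      _ = 0 := by rw [hlast, mul_zero]
  rw [this, sub_zero]

/-! ### Exponent laws over `ℝ`, by the polynomial identity principle -/

section Real

variable {u v : SqFree κ ℝ}

/-- Multiplicativity in the base: `(1-u)^c (1-v)^c = ((1-u)(1-v))^c`. [folklore] -/
private theorem binomB_mul_binomB (hu : u.IsNil) (hv : v.IsNil) (c : ℝ) :
    binomB c u * binomB c v = binomB c (u + v - u * v) := by
  have huv : (u + v - u * v).IsNil := (hu.add hv).sub (hu.mul_left v)
  have key : binomB (Polynomial.X : Polynomial ℝ) (map Polynomial.C u) * binomB Polynomial.X (map Polynomial.C v)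
      = binomB Polynomial.X (map Polynomial.C (u + v - u * v)) := by
    apply eq_of_forall_eval_natCast
    intro k
    simp only [map_mul, map_binomB, Polynomial.coe_evalRingHom, Polynomial.eval_X, map_evalRingHom_map_C]
    rw [binomB_natCast hu, binomB_natCast hv, binomB_natCast huv, ← mul_pow]
    congr 1; ring
  have h := congrArg (map (Polynomial.evalRingHom c)) key
  simpa only [map_mul, map_binomB, Polynomial.coe_evalRingHom, Polynomial.eval_X,
    map_evalRingHom_map_C] using h

/-- Chu–Vandermonde: `(1-u)^a (1-u)^b = (1-u)^{a+b}`. [folklore] -/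
private theorem binomB_mul_binomB_same (hu : u.IsNil) (a b : ℝ) :
    binomB a u * binomB b u = binomB (a + b) u := by
  have key : binomB (Polynomial.X : Polynomial ℝ) (map Polynomial.C u) * map Polynomial.C (binomB b u)
      = binomB (Polynomial.X + Polynomial.C b) (map Polynomial.C u) := by
    apply eq_of_forall_eval_natCast
    intro k
    simp only [map_mul, map_add, map_binomB, Polynomial.coe_evalRingHom, Polynomial.eval_X,
      Polynomial.eval_C, map_evalRingHom_map_C]
    rw [binomB_natCast hu, add_comm (k : ℝ) b, binomB_add_natCast hu, mul_comm]
  have h := congrArg (map (Polynomial.evalRingHom a)) key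
  simpa only [map_mul, map_add, map_binomB, Polynomial.coe_evalRingHom, Polynomial.eval_X,
    Polynomial.eval_C, map_evalRingHom_map_C] using h

/-- `(1-u)^{ks} = ((1-u)^s)^k` for natural `k`. [folklore] -/
private theorem binomB_natCast_mul (hu : u.IsNil) (k : ℕ) (s : ℝ) :
    binomB ((k : ℝ) * s) u = binomB s u ^ k := by
  induction k with
  | zero => rw [Nat.cast_zero, zero_mul, binomB_zero_left u, pow_zero]
  | succ k ih => rw [Nat.cast_succ, add_mul, one_mul, ← binomB_mul_binomB_same hu, ih, pow_succ]

/-- Composition: `(1 - (1 - (1-u)^s))^c = (1-u)^{cs}`. [folklore] -/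
private theorem binomB_one_sub_binomB (hu : u.IsNil) (c s : ℝ) :
    binomB c (1 - binomB s u) = binomB (c * s) u := by
  have hn : (1 - binomB s u).IsNil := isNil_one_sub_binomB hu s
  have key : binomB (Polynomial.X : Polynomial ℝ) (map Polynomial.C (1 - binomB s u))
      = binomB (Polynomial.X * Polynomial.C s) (map Polynomial.C u) := by
    apply eq_of_forall_eval_natCast
    intro k
    simp only [map_binomB, map_sub, map_one, Polynomial.coe_evalRingHom, Polynomial.eval_X,
      Polynomial.eval_mul, Polynomial.eval_C, map_evalRingHom_map_C]
    rw [binomB_natCast hn, binomB_natCast_mul hu, sub_sub_cancel]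
  have h := congrArg (map (Polynomial.evalRingHom c)) key
  simpa only [map_binomB, map_sub, map_one, Polynomial.coe_evalRingHom, Polynomial.eval_X,
    Polynomial.eval_mul, Polynomial.eval_C, map_evalRingHom_map_C] using h

end Real

end SqFree

/-! ## Part D.  Proposition 12: `E_n` as the top square-free coefficient of
`1 - ∏_x (1 - Σ_i t_i f_i(x))^{μ(x)}` -/

namespace SqFree

section Emb

variable {R : Type*} [CommRing R] {n : ℕ}

/-- Indices `i : Fin (n+1)` with `i.succ ∈ τ`. [folklore] -/
def pre (τ : Finset (Fin (n + 2))) : Finset (Fin (n + 1)) := univ.filter fun i => i.succ ∈ τ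

/-- Membership in the preimage index set. [folklore] -/
@[simp] private theorem mem_pre {τ : Finset (Fin (n + 2))} {i : Fin (n + 1)} : i ∈ pre τ ↔ i.succ ∈ τ := by
  simp [pre]

/-- Preimage of a shifted index set. [folklore] -/
private theorem pre_map_succEmb (σ : Finset (Fin (n + 1))) : pre (σ.map (Fin.succEmb (n + 1))) = σ := by
  ext i
  rw [mem_pre]
  constructor
  · intro h
    rw [Finset.mem_map] at h
    obtain ⟨j, hj, hji⟩ := h
    rw [Fin.coe_succEmb] at hji
    rwa [← Fin.succ_injective _ hji]
  · intro h
    rw [Finset.mem_map]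
    exact ⟨i, h, rfl⟩

/-- Shifting back the preimage of an index set avoiding `0`. [folklore] -/
private theorem map_succEmb_pre {τ : Finset (Fin (n + 2))} (h : (0 : Fin (n + 2)) ∉ τ) :
    (pre τ).map (Fin.succEmb (n + 1)) = τ := by
  ext j
  rw [Finset.mem_map]
  constructor
  · rintro ⟨i, hi, rfl⟩; exact mem_pre.1 hi
  · intro hj
    have hj0 : j ≠ 0 := fun h0 => h (h0 ▸ hj)
    refine ⟨j.pred hj0, ?_, ?_⟩
    · rw [mem_pre, Fin.succ_pred]; exact hj
    · rw [Fin.coe_succEmb, Fin.succ_pred]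

/-- Preimage commutes with set difference. [folklore] -/
private theorem pre_sdiff (τ σ : Finset (Fin (n + 2))) : pre (τ \ σ) = pre τ \ pre σ := by
  ext i; simp [pre, mem_sdiff]

/-- Preimage is monotone. [folklore] -/
private theorem pre_mono {σ τ : Finset (Fin (n + 2))} (h : σ ⊆ τ) : pre σ ⊆ pre τ := by
  intro i hi; rw [mem_pre] at hi ⊢; exact h hi

/-- Preimage of the empty index set. [folklore] -/
@[simp] private theorem pre_empty : pre (∅ : Finset (Fin (n + 2))) = ∅ := by
  ext i; simp [pre]

/-- Preimage of an index set avoiding `0` is empty iff the set is. [folklore] -/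
private theorem pre_eq_empty_iff {τ : Finset (Fin (n + 2))} (h : (0 : Fin (n + 2)) ∉ τ) :
    pre τ = ∅ ↔ τ = ∅ := by
  constructor
  · intro hp
    rw [← map_succEmb_pre h, hp, Finset.map_empty]
  · rintro rfl; exact pre_empty

/-- Preimage of all nonzero indices. [folklore] -/
private theorem pre_univ_sdiff_zero : pre ((univ : Finset (Fin (n + 2))) \ {0}) = univ := by
  ext i; simp [pre, Fin.succ_ne_zero]

/-- The coefficient function of the embedding `t_i ↦ t_{i+1}`. [folklore] -/
def embFun (a : SqFree (Fin (n + 1)) R) : SqFree (Fin (n + 2)) R :=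
  ⟨fun τ => if (0 : Fin (n + 2)) ∈ τ then 0 else a.coeff (pre τ)⟩

/-- Coefficients of the embedding. [folklore] -/
private theorem coeff_embFun (a : SqFree (Fin (n + 1)) R) (τ : Finset (Fin (n + 2))) :
    (embFun a).coeff τ = if (0 : Fin (n + 2)) ∈ τ then 0 else a.coeff (pre τ) := rfl

/-- The embedding preserves `1`. [folklore] -/
private theorem embFun_one : embFun (1 : SqFree (Fin (n + 1)) R) = 1 := by
  ext τ
  rw [coeff_embFun, coeff_one, coeff_one]
  by_cases h0 : (0 : Fin (n + 2)) ∈ τ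
  · rw [if_pos h0, if_neg]; rintro rfl; simp at h0
  · rw [if_neg h0]
    by_cases hτ : τ = ∅
    · subst hτ; simp
    · rw [if_neg, if_neg hτ]
      intro hp; exact hτ ((pre_eq_empty_iff h0).1 hp)

/-- The embedding is multiplicative. [folklore] -/
private theorem embFun_mul (a b : SqFree (Fin (n + 1)) R) : embFun (a * b) = embFun a * embFun b := by
  ext τ
  rw [coeff_embFun, coeff_mul, coeff_mul]
  by_cases h0 : (0 : Fin (n + 2)) ∈ τ
  · rw [if_pos h0]
    symm
    refine Finset.sum_eq_zero fun σ _ => ?_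
    by_cases hσ0 : (0 : Fin (n + 2)) ∈ σ
    · rw [coeff_embFun, if_pos hσ0, zero_mul]
    · have : (0 : Fin (n + 2)) ∈ τ \ σ := mem_sdiff.2 ⟨h0, hσ0⟩
      rw [coeff_embFun b, if_pos this, mul_zero]
  · rw [if_neg h0]
    symm
    refine Finset.sum_nbij' pre (fun ρ => ρ.map (Fin.succEmb (n + 1))) ?_ ?_ ?_ ?_ ?_
    · intro σ hσ; exact mem_powerset.2 (pre_mono (mem_powerset.1 hσ))
    · intro ρ hρ
      rw [mem_powerset] at hρ ⊢
      intro j hj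
      rw [Finset.mem_map] at hj
      obtain ⟨i, hi, rfl⟩ := hj
      exact mem_pre.1 (hρ hi)
    · intro σ hσ
      exact map_succEmb_pre fun h => h0 (mem_powerset.1 hσ h)
    · intro ρ _; exact pre_map_succEmb ρ
    · intro σ hσ
      have hστ := mem_powerset.1 hσ
      have hσ0 : (0 : Fin (n + 2)) ∉ σ := fun h => h0 (hστ h)
      have hτσ0 : (0 : Fin (n + 2)) ∉ τ \ σ := fun h => h0 (mem_sdiff.1 h).1
      rw [coeff_embFun, coeff_embFun, if_neg hσ0, if_neg hτσ0, pre_sdiff]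

/-- The algebra embedding `R[t_0..t_n]/(t²) → R[t_0..t_{n+1}]/(t²)`, `t_i ↦ t_{i+1}`. [folklore] -/
def emb : SqFree (Fin (n + 1)) R →+* SqFree (Fin (n + 2)) R where
  toFun := embFun
  map_one' := embFun_one
  map_mul' := embFun_mul
  map_zero' := by ext τ; rw [coeff_embFun]; split_ifs <;> simp
  map_add' a b := by ext τ; simp only [coeff_embFun, coeff_add]; split_ifs <;> simp

/-- Coefficients of the embedding. [folklore] -/
private theorem coeff_emb (a : SqFree (Fin (n + 1)) R) (τ : Finset (Fin (n + 2))) :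
    (emb a).coeff τ = if (0 : Fin (n + 2)) ∈ τ then 0 else a.coeff (pre τ) := rfl

/-- An embedded element has no top coefficient. [folklore] -/
private theorem coeff_emb_univ (a : SqFree (Fin (n + 1)) R) : (emb a).coeff univ = 0 := by
  rw [coeff_emb, if_pos (mem_univ _)]

/-- The embedding on monomials. [folklore] -/
private theorem emb_single (σ : Finset (Fin (n + 1))) (r : R) :
    emb (single σ r) = single (σ.map (Fin.succEmb (n + 1))) r := by
  ext τ
  rw [coeff_emb, coeff_single, coeff_single]
  by_cases h0 : (0 : Fin (n + 2)) ∈ τ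
  · rw [if_pos h0, if_neg]
    rintro rfl
    rw [Finset.mem_map] at h0
    obtain ⟨i, _, hi⟩ := h0
    exact Fin.succ_ne_zero i hi
  · rw [if_neg h0]
    by_cases h : pre τ = σ
    · rw [if_pos h, if_pos]
      rw [← h, map_succEmb_pre h0]
    · rw [if_neg h, if_neg]
      rintro rfl
      exact h (pre_map_succEmb σ)

/-- The embedding fixes constants. [folklore] -/
@[simp] private theorem emb_C (r : R) : emb (C r : SqFree (Fin (n + 1)) R) = C r := by
  rw [C_apply, emb_single, Finset.map_empty]; rfl

/-- The embedding preserves having no constant term. [folklore] -/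
private theorem IsNil.emb {a : SqFree (Fin (n + 1)) R} (ha : a.IsNil) : (emb a).IsNil := by
  unfold IsNil at *
  rw [coeff_emb, if_neg (Finset.notMem_empty _), pre_empty, ha]

/-- Top coefficient of `t_0` times an embedded element. [folklore] -/
private theorem coeff_univ_single_zero_mul_emb (r : R) (a : SqFree (Fin (n + 1)) R) :
    (single {0} r * emb a).coeff univ = r * a.coeff univ := by
  rw [coeff_single_mul, if_pos (subset_univ _), coeff_emb, if_neg (by simp), pre_univ_sdiff_zero]

/-- The embedding commutes with `(1-u)⁻¹`. [folklore] -/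
private theorem emb_inv1 {u : SqFree (Fin (n + 1)) R} (hu : u.IsNil) : emb (inv1 u) = inv1 (emb u) := by
  have hl : (emb u : SqFree (Fin (n + 2)) R) ^ (n + 2) = 0 := by
    rw [← map_pow, hu.pow_eq_zero_of_lt (by simp), map_zero]
  simp only [inv1, Fintype.card_fin, map_sum, map_pow]
  rw [Finset.sum_range_succ _ (n + 2), hl, add_zero]

variable [Algebra ℚ R]

/-- The embedding commutes with binomial powers. [folklore] -/
private theorem emb_binomB {u : SqFree (Fin (n + 1)) R} (hu : u.IsNil) (c : R) :
    emb (binomB c u) = binomB c (emb u) := by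
  have hl : C (rch (n + 2) c) * (-(emb u : SqFree (Fin (n + 2)) R)) ^ (n + 2) = 0 := by
    rw [← map_neg, ← map_pow, hu.neg.pow_eq_zero_of_lt (by simp), map_zero, mul_zero]
  simp only [binomB, Fintype.card_fin, map_sum, map_mul, map_pow, map_neg, emb_C]
  rw [Finset.sum_range_succ _ (n + 2), hl, add_zero]

end Emb

section Lin

variable {R : Type*} [CommRing R] {α : Type*}

/-- The linear form `Σ_i t_i f_i(x)` in the square-free algebra. [cite: Sahi2008, p. 219, `F_n`] -/
def lin {m : ℕ} (f : Fin m → α → R) (x : α) : SqFree (Fin m) R := ∑ i, single {i} (f i x)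

/-- The linear form has no constant term. [folklore] -/
private theorem isNil_lin {m : ℕ} (f : Fin m → α → R) (x : α) : (lin f x).IsNil :=
  IsNil.sum fun i _ => isNil_single (singleton_nonempty i) _

/-- The linear form is homogeneous of degree one. [folklore] -/
private theorem D_lin {m : ℕ} (f : Fin m → α → R) (x : α) : D (lin f x) = lin f x := by
  rw [lin, D_sum]
  refine Finset.sum_congr rfl fun i _ => ?_
  rw [D_single, card_singleton, Nat.cast_one, map_one, one_mul]

/-- The linear form of a `cons` family: `t_0 f + (shifted rest)`. [folklore] -/
private theorem lin_cons {n : ℕ} (g : α → R) (h : Fin (n + 1) → α → R) (x : α) :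
    lin (Matrix.vecCons g h) x = single {0} (g x) + emb (lin h x) := by
  rw [lin, Fin.sum_univ_succ, lin, map_sum]
  congr 1
  refine Finset.sum_congr rfl fun i _ => ?_
  rw [Matrix.cons_val_succ, emb_single, Finset.map_singleton, Fin.coe_succEmb]

/-- Updating one slot changes the linear form by a monomial. [folklore] -/
private theorem lin_update {m : ℕ} (h : Fin m → α → R) (i : Fin m) (v : α → R) (x : α) :
    lin (Function.update h i v) x = lin h x + single {i} (v x - h i x) := by
  rw [lin, lin]
  have : ∀ j ∈ (univ : Finset (Fin m)), single {j} (Function.update h i v j x)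
      = single {j} (h j x) + if j = i then single {i} (v x - h i x) else 0 := by
    intro j _
    by_cases hj : j = i
    · subst hj; rw [Function.update_self, if_pos rfl, ← single_add]; congr 1; ring
    · rw [Function.update_of_ne hj, if_neg hj, add_zero]
  rw [Finset.sum_congr rfl this, Finset.sum_add_distrib, Finset.sum_ite_eq']
  simp

/-- The linear form of the empty family is `0`. [folklore] -/
private theorem lin_fin_zero (f : Fin 0 → α → R) (x : α) : lin f x = 0 := by
  simp [lin]

/-- The linear form of a one-member family. [folklore] -/
private theorem lin_fin_one (f : Fin 1 → α → R) (x : α) : lin f x = single {0} (f 0 x) := by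
  simp [lin]

end Lin

end SqFree

/-! ### The generating-function functional and its identification with `sahiE` -/

section GF

open SqFree

variable {α : Type*} [Fintype α]

/-- The generating-function form of Sahi's functional: the coefficient of `t_0 ⋯ t_{n-1}` in
`1 - ∏_x (1 - Σ_i t_i f_i(x))^{μ(x)}`, computed in `ℝ[t_0,…,t_{n-1}]/(t_i²)`.
[cite: Sahi2008, Prop. 12 (p. 219), eq. (14)] -/
noncomputable def gfE (μ : α → ℝ) (n : ℕ) (f : Fin n → α → ℝ) : ℝ :=
  (1 - ∏ x, binomB (μ x) (lin f x)).coeff univ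

/-- The generating-function functional of the empty family is `0`. [folklore] -/
private theorem gfE_zero (μ : α → ℝ) (f : Fin 0 → α → ℝ) : gfE μ 0 f = 0 := by
  rw [gfE]
  have : ∀ x ∈ (univ : Finset α), binomB (μ x) (lin f x) = 1 := by
    intro x _
    rw [lin_fin_zero, binomB]
    simp [rch_zero]
  rw [Finset.prod_congr rfl this, Finset.prod_const_one, sub_self, coeff_zero]

/-- The generating-function functional of one function is its expectation. [folklore] -/
private theorem gfE_one (μ : α → ℝ) (f : Fin 1 → α → ℝ) : gfE μ 1 f = ex μ (f 0) := by
  have hB : ∀ x ∈ (univ : Finset α), binomB (μ x) (lin f x)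
      = (fun _ => (1 : SqFree (Fin 1) ℝ)) x * (1 - single {0} (μ x * f 0 x)) := by
    intro x _
    rw [lin_fin_one, binomB, Fintype.card_fin]
    simp only [Finset.sum_range_succ, Finset.sum_range_zero, zero_add, rch_zero, map_one, pow_zero,
      mul_one, rch_one, pow_one]
    rw [mul_neg, C_mul_single]; ring
  have hw : ∀ x ∈ (univ : Finset α), ∀ y ∈ (univ : Finset α),
      single ({0} : Finset (Fin 1)) (μ x * f 0 x) * single {0} (μ y * f 0 y) = 0 :=
    fun x _ y _ => single_mul_single_self (singleton_nonempty _) _ _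
  have hu : (univ : Finset (Fin 1)) = {0} := by decide
  rw [gfE, ex, Finset.prod_congr rfl hB, prod_mul_one_sub _ _ _ hw]
  simp only [Finset.prod_const_one, one_mul, sub_sub_cancel, coeff_sum]
  refine Finset.sum_congr rfl fun x _ => ?_
  rw [hu, coeff_single_self]

/-- `∏_x (1 - (U_x + W_x))^{c_x} = (∏_x (1-U_x)^{c_x})·(1 - Σ_x c_x W_x (1-U_x)^{-1})` when all products
`W_x W_y` vanish. [folklore] -/
private theorem SqFree.prod_binomB_add_sqzero {R : Type*} [CommRing R] [Algebra ℚ R] {κ : Type*} [DecidableEq κ]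
    [Fintype κ] {β : Type*} (s : Finset β) (c : β → R) (U W : β → SqFree κ R)
    (hU : ∀ x, (U x).IsNil) (hW : ∀ x, (W x).IsNil) (hWW : ∀ x y, W x * W y = 0) :
    ∏ x ∈ s, binomB (c x) (U x + W x)
      = (∏ x ∈ s, binomB (c x) (U x)) * (1 - ∑ x ∈ s, C (c x) * W x * inv1 (U x)) := by
  have hB : ∀ x ∈ s, binomB (c x) (U x + W x)
      = binomB (c x) (U x) * (1 - C (c x) * W x * inv1 (U x)) := by
    intro x _
    rw [binomB_add_of_mul_self_eq_zero (hU x) (hW x) (hWW x x), binomB_sub_one (hU x)]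
    ring
  rw [Finset.prod_congr rfl hB]
  refine prod_mul_one_sub s _ _ (fun x _ y _ => ?_)
  calc C (c x) * W x * inv1 (U x) * (C (c y) * W y * inv1 (U y))
      = C (c x) * inv1 (U x) * (C (c y) * inv1 (U y)) * (W x * W y) := by ring
    _ = 0 := by rw [hWW, mul_zero]

/-- For `n ≥ 1` the functional is minus the top coefficient of the product. [folklore] -/
private theorem gfE_succ_eq_neg_coeff (μ : α → ℝ) (n : ℕ) (g : Fin (n + 1) → α → ℝ) :
    gfE μ (n + 1) g = -((∏ x, binomB (μ x) (lin g x)).coeff univ) := by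
  rw [gfE, coeff_sub, coeff_one, if_neg (Finset.univ_nonempty.ne_empty), zero_sub]

/-- **The Lieb–Sahi recursion for the generating-function functional** (the heart of
Proposition 12): peeling `t_0`. [cite: Sahi2008, Prop. 12 (p. 219); LiebSahi2021, Prop. 3.3] -/
theorem gfE_cons (μ : α → ℝ) (hμ : ∑ x, μ x = 1) (n : ℕ) (f : α → ℝ) (g : Fin (n + 1) → α → ℝ) :
    gfE μ (n + 2) (Matrix.vecCons f g) =
      (∑ i : Fin (n + 1), gfE μ (n + 1) (Function.update g i (g i * f))) -
        gfE μ (n + 1) g * ex μ f := by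
  classical
  -- notation (everything in `n+1` variables)
  set u : α → SqFree (Fin (n + 1)) ℝ := fun x => lin g x with hu_def
  have hu : ∀ x, (u x).IsNil := fun x => isNil_lin g x
  set Z : SqFree (Fin (n + 1)) ℝ := ∏ x, binomB (μ x) (u x) with hZ_def
  set Iv : α → SqFree (Fin (n + 1)) ℝ := fun x => inv1 (u x) with hIv_def
  set G : ℝ := gfE μ (n + 1) g with hG_def
  have hG : G = -(Z.coeff univ) := gfE_succ_eq_neg_coeff μ n g
  -- (E1) the left-hand side
  have e1 : gfE μ (n + 2) (Matrix.vecCons f g) = ∑ x, μ x * f x * (Z * Iv x).coeff univ := by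
    have hl : ∀ x ∈ (univ : Finset α),
        binomB (μ x) (lin (Matrix.vecCons f g) x) = binomB (μ x) (emb (u x) + single {0} (f x)) := by
      intro x _
      rw [lin_cons]
      congr 1
      exact add_comm _ _
    have hP : ∏ x, binomB (μ x) (emb (u x)) = emb Z := by
      rw [hZ_def, map_prod]
      exact Finset.prod_congr rfl fun x _ => (emb_binomB (hu x) (μ x)).symm
    rw [gfE, Finset.prod_congr rfl hl,
      prod_binomB_add_sqzero univ μ (fun x => emb (u x)) (fun x => single {0} (f x))
        (fun x => (hu x).emb) (fun x => isNil_single (singleton_nonempty _) _)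
        (fun x y => single_mul_single_self (singleton_nonempty _) _ _), hP]
    have : (1 : SqFree (Fin (n + 2)) ℝ) - emb Z * (1 - ∑ x, C (μ x) * single {0} (f x) * inv1 (emb (u x)))
        = (1 - emb Z) + ∑ x, emb Z * (C (μ x) * single {0} (f x) * inv1 (emb (u x))) := by
      rw [mul_sub, mul_one, Finset.mul_sum]; ring
    rw [this, coeff_add, coeff_sub, coeff_one, if_neg (Finset.univ_nonempty.ne_empty), coeff_emb_univ,
      sub_zero, zero_add, coeff_sum]
    refine Finset.sum_congr rfl fun x _ => ?_
    rw [← emb_inv1 (hu x), C_mul_single]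
    have : emb Z * (single {0} (μ x * f x) * emb (inv1 (u x)))
        = single {0} (μ x * f x) * emb (Z * Iv x) := by
      rw [map_mul]; ring
    rw [this, coeff_univ_single_zero_mul_emb]
  -- (E2) each term of the sum
  have e2 : ∀ i : Fin (n + 1), gfE μ (n + 1) (Function.update g i (g i * f))
      = G + ∑ x, μ x * (f x - 1) * (Z * single {i} (g i x) * Iv x).coeff univ := by
    intro i
    have hl : ∀ x ∈ (univ : Finset α), binomB (μ x) (lin (Function.update g i (g i * f)) x)
        = binomB (μ x) (u x + single {i} (g i x * (f x - 1))) := by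
      intro x _
      rw [lin_update, Pi.mul_apply]
      congr 2; ring
    rw [gfE, Finset.prod_congr rfl hl,
      prod_binomB_add_sqzero univ μ u (fun x => single {i} (g i x * (f x - 1))) hu
        (fun x => isNil_single (singleton_nonempty _) _)
        (fun x y => single_mul_single_self (singleton_nonempty _) _ _)]
    have : (1 : SqFree (Fin (n + 1)) ℝ) - Z * (1 - ∑ x, C (μ x) * single {i} (g i x * (f x - 1)) * inv1 (u x))
        = (1 - Z) + ∑ x, Z * (C (μ x) * single {i} (g i x * (f x - 1)) * inv1 (u x)) := by
      rw [mul_sub, mul_one, Finset.mul_sum]; ring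
    rw [this, coeff_add, coeff_sum, hG_def, gfE]
    congr 1
    refine Finset.sum_congr rfl fun x _ => ?_
    rw [mul_comm (g i x) (f x - 1), ← C_mul_single]
    have : Z * (C (μ x) * (C (f x - 1) * single {i} (g i x)) * inv1 (u x))
        = C (μ x * (f x - 1)) * (Z * single {i} (g i x) * Iv x) := by
      rw [map_mul]; ring
    rw [this, coeff_C_mul]
  -- (E3) summing the single-variable terms recovers `u x`
  have e3 : ∀ x, ∑ i : Fin (n + 1), (Z * single {i} (g i x) * Iv x).coeff univ = (Z * Iv x).coeff univ + G := by
    intro x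
    rw [← coeff_sum]
    have : ∑ i : Fin (n + 1), Z * single {i} (g i x) * Iv x = Z * (u x * Iv x) := by
      rw [hu_def]; simp only [lin]; rw [Finset.sum_mul, Finset.mul_sum]
      exact Finset.sum_congr rfl fun i _ => by ring
    rw [this, mul_inv1 (hu x), mul_sub, mul_one, coeff_sub, hG]
    ring
  -- (E4) the branching identity, from the degree derivation
  have e4 : ∑ x, μ x * (Z * Iv x).coeff univ = n * G := by
    have hD : D Z = Z - ∑ x, C (μ x) * (Z * Iv x) := by
      rw [hZ_def, D_prod]
      have ht : ∀ x ∈ (univ : Finset α),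
          (∏ y ∈ univ.erase x, binomB (μ y) (u y)) * D (binomB (μ x) (u x))
            = C (μ x) * Z - C (μ x) * (Z * Iv x) := by
        intro x _
        rw [D_binomB (hu x), D_lin, binomB_sub_one (hu x)]
        have : (∏ y ∈ univ.erase x, binomB (μ y) (u y)) *
            -(C (μ x) * lin g x * (binomB (μ x) (u x) * inv1 (u x)))
            = -(C (μ x) * (u x * inv1 (u x)) *
                ((∏ y ∈ univ.erase x, binomB (μ y) (u y)) * binomB (μ x) (u x))) := by
          rw [hu_def]; ring
        rw [this, Finset.prod_erase_mul _ _ (mem_univ x), mul_inv1 (hu x)]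
        ring
      rw [Finset.sum_congr rfl ht, Finset.sum_sub_distrib, ← Finset.sum_mul, ← map_sum, hμ, map_one,
        one_mul]
    have hc : ((n : ℝ) + 1) * Z.coeff univ = Z.coeff univ - ∑ x, μ x * (Z * Iv x).coeff univ := by
      have h := congrArg (fun z => z.coeff univ) hD
      simp only [coeff_D, SqFree.coeff_sub, SqFree.coeff_sum, coeff_C_mul, Finset.card_univ,
        Fintype.card_fin, Nat.cast_add, Nat.cast_one] at h
      exact h
    rw [hG]
    linear_combination hc
  -- assemble
  have hsum : ∑ i : Fin (n + 1), gfE μ (n + 1) (Function.update g i (g i * f))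
      = (n + 1) * G + ∑ x, μ x * (f x - 1) * ((Z * Iv x).coeff univ + G) := by
    simp only [e2, Finset.sum_add_distrib, Finset.sum_const, Finset.card_univ, Fintype.card_fin,
      nsmul_eq_mul]
    push_cast
    congr 1
    rw [Finset.sum_comm]
    refine Finset.sum_congr rfl fun x _ => ?_
    rw [← Finset.mul_sum, e3]
  have hexp : ∑ x, μ x * (f x - 1) * ((Z * Iv x).coeff univ + G)
      = (∑ x, μ x * f x * (Z * Iv x).coeff univ) - (∑ x, μ x * (Z * Iv x).coeff univ) + G * (∑ x, μ x * f x) - G * ∑ x, μ x := by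
    rw [Finset.mul_sum, Finset.mul_sum, ← Finset.sum_sub_distrib, ← Finset.sum_add_distrib,
      ← Finset.sum_sub_distrib]
    exact Finset.sum_congr rfl fun x _ => by ring
  have hexf : ex μ f = ∑ x, μ x * f x := rfl
  rw [hsum, hexp, e1, e4, hμ, hexf]
  ring

/-- **Sahi 2008, Proposition 12 (polarization), square-free form.**  For a probability weight `μ`,
Sahi's functional `E_n(f_0,…,f_{n-1})` (in the tree: the Lieb–Sahi recursion `sahiE`) is the
coefficient of `t_0 t_1 ⋯ t_{n-1}` in `1 - ∏_x (1 - Σ_i t_i f_i(x))^{μ(x)}`.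
Deviation from print: Sahi expands in `ℝ[[t]]` after the specialisation `t_i = t^{k_i}`; here the
expansion is done in `ℝ[t_0,…,t_{n-1}]/(t_i²)`, where all binomial series are finite.
[cite: Sahi2008, Prop. 12 (p. 219), eq. (14); LiebSahi2021, Prop. 3.3] -/
theorem sahiE_eq_gfE (μ : α → ℝ) (hμ : ∑ x, μ x = 1) :
    ∀ (n : ℕ) (f : Fin n → α → ℝ), sahiE μ n f = gfE μ n f
  | 0, f => by rw [gfE_zero, sahiE_zero]
  | 1, f => by rw [gfE_one, sahiE_one_apply]
  | n + 2, f => by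
    have hf : f = Matrix.vecCons (f 0) (Fin.tail f) := (Fin.cons_self_tail f).symm
    rw [hf, gfE_cons μ hμ, sahiE_cons]
    simp only [sahiE_eq_gfE μ hμ (n + 1)]

end GF

/-! ## Part C.  The cumulation cone `𝒞[X]` and Theorem 1 -/

section Cone

open SqFree

variable {ι : Type*} [DecidableEq ι]

/-- `g` agrees, on the subsets of `X`, with the cumulation `c⁺(T) = Σ_{S ⊆ T} c(S)` of a
nonnegative function `c` — membership in Sahi's cone `𝒞[X]`. [cite: Sahi2008, eq. (1) and the
definition of `𝒞[X]` (p. 210)] -/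
def IsCumulOn (X : Finset ι) (g : Finset ι → ℝ) : Prop :=
  ∃ c : Finset ι → ℝ, (∀ S, 0 ≤ c S) ∧ ∀ T, T ⊆ X → g T = ∑ S ∈ T.powerset, c S

namespace IsCumulOn

variable {X : Finset ι} {g g' : Finset ι → ℝ}

omit [DecidableEq ι] in
/-- Invariance under pointwise equality on the relevant sets. [folklore] -/
private theorem congr (h : IsCumulOn X g) (hgg' : ∀ T, T ⊆ X → g T = g' T) : IsCumulOn X g' := by
  obtain ⟨c, hc0, hc⟩ := h
  exact ⟨c, hc0, fun T hT => (hgg' T hT).symm.trans (hc T hT)⟩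

omit [DecidableEq ι] in
/-- Restriction to a smaller ground set. [folklore] -/
private theorem anti {Y : Finset ι} (h : IsCumulOn X g) (hYX : Y ⊆ X) : IsCumulOn Y g := by
  obtain ⟨c, hc0, hc⟩ := h
  exact ⟨c, hc0, fun T hT => hc T (hT.trans hYX)⟩

omit [DecidableEq ι] in
/-- `f(∅) = c(∅) ≥ 0`. [cite: Sahi2008, Lemma 8] -/
theorem apply_empty_nonneg (h : IsCumulOn X g) : 0 ≤ g ∅ := by
  obtain ⟨c, hc0, hc⟩ := h
  rw [hc ∅ (empty_subset X), powerset_empty, sum_singleton]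
  exact hc0 ∅

/-- Nonnegative constants are cumulations. [folklore] -/
private theorem const {r : ℝ} (hr : 0 ≤ r) : IsCumulOn X (fun _ => r) := by
  refine ⟨fun S => if S = ∅ then r else 0, fun S => ?_, fun T _ => ?_⟩
  · show 0 ≤ (if S = ∅ then r else 0)
    split_ifs
    · exact hr
    · exact le_rfl
  · show r = ∑ S ∈ T.powerset, (if S = ∅ then r else 0)
    rw [Finset.sum_ite_eq', if_pos (empty_mem_powerset T)]

/-- The zero case. [folklore] -/
private theorem zero : IsCumulOn X (fun _ => (0 : ℝ)) := const le_rfl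

omit [DecidableEq ι] in
/-- Closure under addition. [folklore] -/
private theorem add (h : IsCumulOn X g) (h' : IsCumulOn X g') : IsCumulOn X (fun T => g T + g' T) := by
  obtain ⟨c, hc0, hc⟩ := h
  obtain ⟨c', hc0', hc'⟩ := h'
  refine ⟨fun S => c S + c' S, fun S => add_nonneg (hc0 S) (hc0' S), fun T hT => ?_⟩
  show g T + g' T = _
  rw [hc T hT, hc' T hT, ← sum_add_distrib]

omit [DecidableEq ι] in
/-- Closure under nonnegative scalars. [folklore] -/
private theorem smul {r : ℝ} (hr : 0 ≤ r) (h : IsCumulOn X g) : IsCumulOn X (fun T => r * g T) := by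
  obtain ⟨c, hc0, hc⟩ := h
  refine ⟨fun S => r * c S, fun S => mul_nonneg hr (hc0 S), fun T hT => ?_⟩
  show r * g T = _
  rw [hc T hT, mul_sum]

/-- Closure under finite sums. [folklore] -/
private theorem sum {β : Type*} (s : Finset β) {G : β → Finset ι → ℝ} (h : ∀ b ∈ s, IsCumulOn X (G b)) :
    IsCumulOn X (fun T => ∑ b ∈ s, G b T) := by
  induction s using Finset.cons_induction with
  | empty => simpa using (zero : IsCumulOn X _)
  | cons b s hb ih =>
    have := (h b (mem_cons_self b s)).add (ih fun b' hb' => h b' (mem_cons_of_mem hb'))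
    refine this.congr fun T _ => ?_
    rw [sum_cons]

/-- **Sahi 2008, Lemma 11**: the cone `𝒞[X]` is closed under pointwise products
(`1_{↑S} · 1_{↑S'} = 1_{↑(S ∪ S')}`). [cite: Sahi2008, Lemma 11 (p. 217)] -/
theorem mul (h : IsCumulOn X g) (h' : IsCumulOn X g') : IsCumulOn X (fun T => g T * g' T) := by
  obtain ⟨c, hc0, hc⟩ := h
  obtain ⟨c', hc0', hc'⟩ := h'
  let F : Finset ι → Finset ι → Finset ι → ℝ := fun U S S' => if S ∪ S' = U then c S * c' S' else 0
  have hF : ∀ U S S', ¬ (S ⊆ U ∧ S' ⊆ U) → F U S S' = 0 := by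
    intro U S S' hn
    simp only [F]
    rw [if_neg]
    intro hU; apply hn; rw [← hU]; exact ⟨subset_union_left, subset_union_right⟩
  refine ⟨fun U => ∑ S ∈ U.powerset, ∑ S' ∈ U.powerset, F U S S',
    fun U => sum_nonneg fun S _ => sum_nonneg fun S' _ => ?_, fun T hT => ?_⟩
  · simp only [F]
    split_ifs
    · exact mul_nonneg (hc0 S) (hc0' S')
    · exact le_rfl
  show g T * g' T = _
  rw [hc T hT, hc' T hT, sum_mul_sum]
  have step1 : ∑ S ∈ T.powerset, ∑ S' ∈ T.powerset, c S * c' S'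
      = ∑ S ∈ T.powerset, ∑ S' ∈ T.powerset, ∑ U ∈ T.powerset, F U S S' := by
    refine sum_congr rfl fun S hS => sum_congr rfl fun S' hS' => ?_
    simp only [F]
    rw [Finset.sum_ite_eq, if_pos]
    exact mem_powerset.2 (union_subset (mem_powerset.1 hS) (mem_powerset.1 hS'))
  have step2 : ∑ S ∈ T.powerset, ∑ S' ∈ T.powerset, ∑ U ∈ T.powerset, F U S S'
      = ∑ U ∈ T.powerset, ∑ S ∈ T.powerset, ∑ S' ∈ T.powerset, F U S S' := by
    calc ∑ S ∈ T.powerset, ∑ S' ∈ T.powerset, ∑ U ∈ T.powerset, F U S S'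
        = ∑ S ∈ T.powerset, ∑ U ∈ T.powerset, ∑ S' ∈ T.powerset, F U S S' :=
          sum_congr rfl fun S _ => sum_comm
      _ = ∑ U ∈ T.powerset, ∑ S ∈ T.powerset, ∑ S' ∈ T.powerset, F U S S' := sum_comm
  have step3 : ∀ U ∈ T.powerset, ∑ S ∈ U.powerset, ∑ S' ∈ U.powerset, F U S S'
      = ∑ S ∈ T.powerset, ∑ S' ∈ T.powerset, F U S S' := by
    intro U hU
    have hUT : U.powerset ⊆ T.powerset := powerset_mono.2 (mem_powerset.1 hU)
    have inner : ∀ S, ∑ S' ∈ U.powerset, F U S S' = ∑ S' ∈ T.powerset, F U S S' := by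
      intro S
      apply sum_subset hUT
      intro S' _ hS'
      exact hF U S S' fun hh => hS' (mem_powerset.2 hh.2)
    rw [sum_congr rfl fun S _ => inner S]
    apply sum_subset hUT
    intro S _ hS
    exact sum_eq_zero fun S' _ => hF U S S' fun hh => hS (mem_powerset.2 hh.1)
  rw [step1, step2]
  exact sum_congr rfl fun U hU => (step3 U hU).symm

/-- Closure under powers. [folklore] -/
private theorem pow (h : IsCumulOn X g) : ∀ k : ℕ, IsCumulOn X (fun T => g T ^ k)
  | 0 => by simpa using (const zero_le_one : IsCumulOn X _)
  | k + 1 => by simpa [pow_succ] using (pow h k).mul h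

end IsCumulOn

/-- A `SqFree`-valued set function is `𝒞[X]`-valued when every coefficient function is.
[cite: Sahi2008, the cone `𝒞[X]` of `R[X]`-valued functions (p. 209–210)] -/
def CVal {κ : Type*} (X : Finset ι) (A : Finset ι → SqFree κ ℝ) : Prop :=
  ∀ τ, IsCumulOn X (fun T => (A T).coeff τ)

namespace CVal

variable {κ : Type*} [DecidableEq κ] {X : Finset ι} {A B : Finset ι → SqFree κ ℝ}

omit [DecidableEq ι] [DecidableEq κ] in
/-- Invariance under pointwise equality on the relevant sets. [folklore] -/
private theorem congr (h : CVal X A) (hAB : ∀ T, T ⊆ X → A T = B T) : CVal X B :=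
  fun τ => (h τ).congr fun T hT => by rw [hAB T hT]

omit [DecidableEq ι] [DecidableEq κ] in
/-- Restriction to a smaller ground set. [folklore] -/
private theorem anti {Y : Finset ι} (h : CVal X A) (hYX : Y ⊆ X) : CVal Y A := fun τ => (h τ).anti hYX

/-- The constant `1` is cumulation-valued. [folklore] -/
private theorem one : CVal X (fun _ => (1 : SqFree κ ℝ)) := by
  intro τ
  by_cases h : τ = ∅
  · have e : (fun _ : Finset ι => (1 : SqFree κ ℝ).coeff τ) = fun _ => (1 : ℝ) := by
      funext T; rw [coeff_one, if_pos h]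
    rw [e]; exact IsCumulOn.const zero_le_one
  · have e : (fun _ : Finset ι => (1 : SqFree κ ℝ).coeff τ) = fun _ => (0 : ℝ) := by
      funext T; rw [coeff_one, if_neg h]
    rw [e]; exact IsCumulOn.zero

omit [DecidableEq ι] [DecidableEq κ] in
/-- Closure under addition. [folklore] -/
private theorem add (hA : CVal X A) (hB : CVal X B) : CVal X (fun T => A T + B T) := fun τ => by
  simpa using (hA τ).add (hB τ)

omit [DecidableEq ι] in
/-- Closure under nonnegative constant multiples. [folklore] -/
private theorem C_mul {r : ℝ} (hr : 0 ≤ r) (hA : CVal X A) : CVal X (fun T => C r * A T) := fun τ => by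
  simpa using (hA τ).smul hr

/-- Closure under products. [folklore] -/
private theorem mul (hA : CVal X A) (hB : CVal X B) : CVal X (fun T => A T * B T) := fun τ => by
  simp only [coeff_mul]
  exact IsCumulOn.sum (G := fun σ T => (A T).coeff σ * (B T).coeff (τ \ σ)) τ.powerset
    fun σ _ => (hA σ).mul (hB (τ \ σ))

/-- Closure under finite sums. [folklore] -/
private theorem sum {β : Type*} (s : Finset β) {F : β → Finset ι → SqFree κ ℝ} (h : ∀ b ∈ s, CVal X (F b)) :
    CVal X (fun T => ∑ b ∈ s, F b T) := fun τ => by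
  simp only [coeff_sum]
  exact IsCumulOn.sum s fun b hb => h b hb τ

/-- Closure under powers. [folklore] -/
private theorem pow (hA : CVal X A) : ∀ k : ℕ, CVal X (fun T => A T ^ k)
  | 0 => by simpa using (one : CVal X _)
  | k + 1 => by simpa [pow_succ] using (pow hA k).mul hA

/-- Closure under `(1-u)⁻¹ = Σ_j u^j`. [folklore] -/
private theorem inv1 [Fintype κ] (hA : CVal X A) : CVal X (fun T => SqFree.inv1 (A T)) := by
  unfold SqFree.inv1
  exact sum (F := fun j T => A T ^ j) _ fun j _ => hA.pow j

end CVal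

/-! ### Product weights on the subsets of `X` -/

/-- The product weight `μ_X(T) = ∏_{x∈X} (m_x if x ∈ T else 1 - m_x)` on the subsets `T ⊆ X`.
[cite: Sahi2008, eq. (2) (p. 210)] -/
def prodWt (m : ι → ℝ) (X : Finset ι) (T : Finset ι) : ℝ := ∏ x ∈ X, if x ∈ T then m x else 1 - m x

/-- The product weight on the empty ground set is `1`. [folklore] -/
private theorem prodWt_empty (m : ι → ℝ) (T : Finset ι) : prodWt m ∅ T = 1 := prod_empty

/-- Product weight of a set missing the new point. [folklore] -/
private theorem prodWt_insert_of_not_mem {m : ι → ℝ} {x : ι} {X T : Finset ι} (hx : x ∉ X) (hxT : x ∉ T) :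
    prodWt m (insert x X) T = (1 - m x) * prodWt m X T := by
  rw [prodWt, prod_insert hx, if_neg hxT]; rfl

/-- Product weight of a set containing the new point. [folklore] -/
private theorem prodWt_insert_insert {m : ι → ℝ} {x : ι} {X : Finset ι} (hx : x ∉ X) (T : Finset ι) :
    prodWt m (insert x X) (insert x T) = m x * prodWt m X T := by
  rw [prodWt, prod_insert hx, if_pos (mem_insert_self _ _), prodWt]
  congr 1
  refine prod_congr rfl fun y hy => ?_
  have hyx : y ≠ x := fun h => hx (h ▸ hy)
  simp [mem_insert, hyx]

/-- The product weights sum to `1`. [folklore] -/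
private theorem sum_prodWt (m : ι → ℝ) (X : Finset ι) : ∑ T ∈ X.powerset, prodWt m X T = 1 := by
  induction X using Finset.induction_on with
  | empty => simp [prodWt_empty]
  | insert x X hx ih =>
    rw [sum_powerset_insert hx]
    have h1 : ∑ T ∈ X.powerset, prodWt m (insert x X) T = (1 - m x) * ∑ T ∈ X.powerset, prodWt m X T := by
      rw [mul_sum]
      refine sum_congr rfl fun T hT => prodWt_insert_of_not_mem hx fun h => hx (mem_powerset.1 hT h)
    have h2 : ∑ T ∈ X.powerset, prodWt m (insert x X) (insert x T) = m x * ∑ T ∈ X.powerset, prodWt m X T := by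
      rw [mul_sum]
      refine sum_congr rfl fun T _ => prodWt_insert_insert hx T
    rw [h1, h2, ih]; ring

/-- Constant term of a product. [folklore] -/
private theorem SqFree.coeff_empty_mul {κ : Type*} [DecidableEq κ] {R : Type*} [CommRing R] (a b : SqFree κ R) :
    (a * b).coeff ∅ = a.coeff ∅ * b.coeff ∅ := by
  rw [coeff_mul, powerset_empty, sum_singleton, sdiff_self]; rfl

/-- **Sahi 2008, Theorem 1** (square-free form), the inductive statement on the ground set `X`:
for a product weight with parameters in `[0,1]` and a `𝒞[X]`-valued `G` without constant terms,
every coefficient of `1 - ∏_{T ⊆ X} (1 - G(T))^{μ_X(T)}` is nonnegative.  The induction step is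
Sahi's one-variable elimination (12): `1 - G_x := (1 - G⁰)^{1-m_x} (1 - G¹)^{m_x}` on `X ∖ x`, with
`G_x = G⁰ + Σ_{k≥1} β_k D^k (1 - G⁰)^{1-k} ∈ 𝒞[X ∖ x]`. [cite: Sahi2008, Thm. 1 (p. 210), proof
pp. 215–219 (Lemmas 7–11, eq. (12))] -/
theorem sahi2008_thm1_aux {κ : Type*} [DecidableEq κ] [Fintype κ] (m : ι → ℝ)
    (h0 : ∀ x, 0 ≤ m x) (h1 : ∀ x, m x ≤ 1) (X : Finset ι) :
    ∀ (G : Finset ι → SqFree κ ℝ), (∀ T, (G T).IsNil) → CVal X G →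
      ∀ τ, 0 ≤ (1 - ∏ T ∈ X.powerset, binomB (prodWt m X T) (G T)).coeff τ := by
  induction X using Finset.induction_on with
  | empty =>
    intro G hG hC τ
    rw [powerset_empty, prod_singleton, prodWt_empty, binomB_one_left (hG ∅), sub_sub_cancel]
    obtain ⟨c, hc0, hc⟩ := hC τ
    have h0' : (G ∅).coeff τ = ∑ S ∈ (∅ : Finset ι).powerset, c S := hc ∅ (empty_subset _)
    rw [powerset_empty, sum_singleton] at h0'
    rw [h0']; exact hc0 ∅
  | insert x X' hx ih =>
    intro G hG hC τ
    set N := Fintype.card κ with hN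
    -- Sahi's `F_x`
    set Gx : Finset ι → SqFree κ ℝ :=
      fun T => 1 - binomB (1 - m x) (G T) * binomB (m x) (G (insert x T)) with hGx_def
    -- regroup the product (one-variable elimination, eq. (12))
    have hprod : ∏ T ∈ (insert x X').powerset, binomB (prodWt m (insert x X') T) (G T)
        = ∏ T ∈ X'.powerset, binomB (prodWt m X' T) (Gx T) := by
      rw [Finset.prod_powerset_insert hx, ← prod_mul_distrib]
      refine prod_congr rfl fun T hT => ?_
      have hTX : T ⊆ X' := mem_powerset.1 hT
      have hxT : x ∉ T := fun h => hx (hTX h)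
      rw [prodWt_insert_of_not_mem hx hxT, prodWt_insert_insert hx T, mul_comm (1 - m x),
        mul_comm (m x), ← binomB_one_sub_binomB (hG T), ← binomB_one_sub_binomB (hG _),
        binomB_mul_binomB (isNil_one_sub_binomB (hG T) _) (isNil_one_sub_binomB (hG _) _)]
      congr 1
      simp only [hGx_def]; ring
    rw [hprod]
    -- the difference `D = G¹ - G⁰` and the expansion of `G_x`
    set Df : Finset ι → SqFree κ ℝ := fun T => G (insert x T) - G T with hDf_def
    have hDnil : ∀ T, (Df T).IsNil := fun T => (hG _).sub (hG T)
    have hGa : CVal X' G := hC.anti (subset_insert x X')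
    have hDC : CVal X' Df := by
      intro τ'
      obtain ⟨c, hc0, hc⟩ := hC τ'
      refine ⟨fun S => c (insert x S), fun S => hc0 _, fun T hT => ?_⟩
      have hxT : x ∉ T := fun h => hx (hT h)
      have e1 : (G (insert x T)).coeff τ' = ∑ S ∈ (insert x T).powerset, c S :=
        hc (insert x T) (insert_subset_insert x hT)
      have e2 : (G T).coeff τ' = ∑ S ∈ T.powerset, c S := hc T (hT.trans (subset_insert x X'))
      show (G (insert x T) - G T).coeff τ' = _
      rw [SqFree.coeff_sub, e1, e2, sum_powerset_insert hxT]
      ring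
    have hexp : ∀ T, T ⊆ X' → Gx T = G T + ∑ k ∈ range N,
        C ((-1 : ℝ) ^ k * rch (k + 1) (m x)) * (Df T ^ (k + 1) * inv1 (G T) ^ k) := by
      intro T _
      have ha := hG T
      have he : (Df T * inv1 (G T)).IsNil := (hDnil T).mul_left _
      have hD : G (insert x T) = G T + Df T := by simp only [hDf_def]; ring
      have had : G (insert x T) = G T + Df T * inv1 (G T) - G T * (Df T * inv1 (G T)) := by
        calc G (insert x T) = G T + Df T * ((1 - G T) * inv1 (G T)) := by
              rw [one_sub_mul_inv1 ha, mul_one, ← hD]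
          _ = _ := by ring
      have hGxT : Gx T = 1 - binomB (1 - m x) (G T) * binomB (m x) (G (insert x T)) := rfl
      have key : ∀ k : ℕ, (1 - G T) * (C ((-1 : ℝ) ^ k * rch (k + 1) (m x)) * (Df T * inv1 (G T)) ^ (k + 1))
          = C ((-1 : ℝ) ^ k * rch (k + 1) (m x)) * (Df T ^ (k + 1) * inv1 (G T) ^ k) := by
        intro k
        rw [mul_pow, pow_succ' (inv1 (G T)) k]
        calc (1 - G T) * (C ((-1 : ℝ) ^ k * rch (k + 1) (m x)) * (Df T ^ (k + 1) * (inv1 (G T) * inv1 (G T) ^ k)))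
            = C ((-1 : ℝ) ^ k * rch (k + 1) (m x)) * (Df T ^ (k + 1) * (((1 - G T) * inv1 (G T)) * inv1 (G T) ^ k)) := by
              ring
          _ = C ((-1 : ℝ) ^ k * rch (k + 1) (m x)) * (Df T ^ (k + 1) * inv1 (G T) ^ k) := by
              rw [one_sub_mul_inv1 ha, one_mul]
      rw [hGxT, had, ← binomB_mul_binomB ha he, ← mul_assoc, binomB_mul_binomB_same ha, sub_add_cancel,
        binomB_one_left ha, binomB_eq_one_sub (m x) (Df T * inv1 (G T)), mul_sub, mul_one, mul_sum,
        ← sum_congr rfl fun k _ => key k]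
      ring
    -- `G_x` is `𝒞[X']`-valued and has no constant terms
    have hGxC : CVal X' Gx := by
      refine CVal.congr ?_ (fun T hT => (hexp T hT).symm)
      refine hGa.add (CVal.sum (F := fun k T => C ((-1 : ℝ) ^ k * rch (k + 1) (m x)) *
        (Df T ^ (k + 1) * inv1 (G T) ^ k)) _ fun k _ => CVal.C_mul ?_ ((hDC.pow (k + 1)).mul (hGa.inv1.pow k)))
      exact neg_one_pow_mul_rch_succ_nonneg (h0 x) (h1 x) k
    have hGxnil : ∀ T, (Gx T).IsNil := by
      intro T
      simp only [hGx_def, IsNil, SqFree.coeff_sub, SqFree.coeff_one, coeff_empty_mul,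
        coeff_empty_binomB (hG T), coeff_empty_binomB (hG _)]
      norm_num
    exact ih Gx hGxnil hGxC τ

end Cone

/-! ## Part E.  Theorems 1 and 2 for product measures on `2^ι` -/

section Main

open SqFree

variable {ι : Type*} [DecidableEq ι] [Fintype ι]

/-- The product (Bernoulli) weight `μ(T) = ∏_{x ∈ T} m_x ∏_{x ∉ T} (1 - m_x)` on the Boolean lattice
`Finset ι`. [cite: Sahi2008, eq. (2) (p. 210)] -/
def finsetProdWeight (m : ι → ℝ) (T : Finset ι) : ℝ := ∏ x, if x ∈ T then m x else 1 - m x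

/-- The product weight is the ground-set product weight at `X = ι`. [folklore] -/
private theorem finsetProdWeight_eq_prodWt (m : ι → ℝ) (T : Finset ι) : finsetProdWeight m T = prodWt m univ T := rfl

/-- The product weight is a probability weight. [cite: Sahi2008, eq. (2) (p. 210)] -/
theorem sum_finsetProdWeight (m : ι → ℝ) : ∑ T, finsetProdWeight m T = 1 := by
  have h := sum_prodWt m (univ : Finset ι)
  rwa [Finset.powerset_univ] at h

/-- The product weight is nonnegative for parameters in `[0,1]`. [cite: Sahi2008, eq. (2) (p. 210)] -/
theorem finsetProdWeight_nonneg {m : ι → ℝ} (h0 : ∀ x, 0 ≤ m x) (h1 : ∀ x, m x ≤ 1) (T : Finset ι) :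
    0 ≤ finsetProdWeight m T :=
  prod_nonneg fun x _ => by
    by_cases h : x ∈ T
    · rw [if_pos h]; exact h0 x
    · rw [if_neg h]; linarith [h1 x]

/-- Membership in Sahi's CUMULATION CONE `𝒞[X]` (`X = ι`): `g = c⁺`, `c⁺(T) = Σ_{S ⊆ T} c(S)`, for a
nonnegative `c` — equivalently, `g` is a nonnegative combination of indicators of principal up-sets
`{T : S ⊆ T}`. [cite: Sahi2008, eq. (1) and `𝒞[X] := {F⁺ | F ∈ 𝒫[X]}` (p. 210); Lemma 8] -/
def IsCumulation (g : Finset ι → ℝ) : Prop :=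
  ∃ c : Finset ι → ℝ, (∀ S, 0 ≤ c S) ∧ ∀ T, g T = ∑ S ∈ T.powerset, c S

omit [DecidableEq ι] [Fintype ι] in
/-- A cumulation is a cumulation on every ground set. [folklore] -/
private theorem IsCumulation.isCumulOn {g : Finset ι → ℝ} (h : IsCumulation g) (X : Finset ι) : IsCumulOn X g := by
  obtain ⟨c, hc0, hc⟩ := h
  exact ⟨c, hc0, fun T _ => hc T⟩

omit [Fintype ι] in
/-- The indicator of a principal up-set `{T : S ⊆ T}` is a cumulation. [cite: Sahi2008, p. 210] -/
theorem isCumulation_indicator_supset (S : Finset ι) :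
    IsCumulation (fun T => if S ⊆ T then (1 : ℝ) else 0) := by
  refine ⟨fun S' => if S' = S then 1 else 0, fun S' => ?_, fun T => ?_⟩
  · show (0 : ℝ) ≤ (if S' = S then 1 else 0)
    split_ifs <;> norm_num
  · show (if S ⊆ T then (1 : ℝ) else 0) = ∑ S' ∈ T.powerset, (if S' = S then 1 else 0)
    rw [Finset.sum_ite_eq']
    by_cases h : S ⊆ T
    · rw [if_pos h, if_pos (mem_powerset.2 h)]
    · rw [if_neg h, if_neg (fun h' => h (mem_powerset.1 h'))]

omit [DecidableEq ι] [Fintype ι] in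
/-- Closure under addition. [cite: Sahi2008, §1 (p. 210)] -/
theorem IsCumulation.add {g g' : Finset ι → ℝ} (h : IsCumulation g) (h' : IsCumulation g') :
    IsCumulation (fun T => g T + g' T) := by
  obtain ⟨c, hc0, hc⟩ := h
  obtain ⟨c', hc0', hc'⟩ := h'
  exact ⟨fun S => c S + c' S, fun S => add_nonneg (hc0 S) (hc0' S), fun T => by
    show g T + g' T = _
    rw [hc T, hc' T, ← sum_add_distrib]⟩

omit [DecidableEq ι] [Fintype ι] in
/-- Closure under nonnegative scalars. [cite: Sahi2008, §3.2 (p. 217)] -/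
theorem IsCumulation.smul {g : Finset ι → ℝ} {r : ℝ} (hr : 0 ≤ r) (h : IsCumulation g) :
    IsCumulation (fun T => r * g T) := by
  obtain ⟨c, hc0, hc⟩ := h
  exact ⟨fun S => r * c S, fun S => mul_nonneg hr (hc0 S), fun T => by
    show r * g T = _
    rw [hc T, mul_sum]⟩

/-- **Sahi 2008, Lemma 11**: `𝒞` is closed under products. [cite: Sahi2008, Lemma 11 (p. 217)] -/
theorem IsCumulation.mul {g g' : Finset ι → ℝ} (h : IsCumulation g) (h' : IsCumulation g') :
    IsCumulation (fun T => g T * g' T) := by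
  obtain ⟨c, hc0, hc⟩ := (h.isCumulOn univ).mul (h'.isCumulOn univ)
  exact ⟨c, hc0, fun T => hc T (subset_univ T)⟩

omit [DecidableEq ι] [Fintype ι] in
/-- Elements of `𝒞` are nonnegative (`𝒞 ⊆ 𝒫`). [cite: Sahi2008, p. 210] -/
theorem IsCumulation.nonneg {g : Finset ι → ℝ} (h : IsCumulation g) (T : Finset ι) : 0 ≤ g T := by
  obtain ⟨c, hc0, hc⟩ := h
  rw [hc T]; exact sum_nonneg fun S _ => hc0 S

omit [DecidableEq ι] [Fintype ι] in
/-- Elements of `𝒞` are monotone (`𝒞 ⊆ ℐ`). [cite: Sahi2008, p. 210 ("`𝒞[X]` is a subcone of `ℐ[X]`")] -/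
theorem IsCumulation.monotone {g : Finset ι → ℝ} (h : IsCumulation g) : Monotone g := by
  obtain ⟨c, hc0, hc⟩ := h
  intro T T' hTT'
  rw [hc T, hc T']
  exact sum_le_sum_of_subset_of_nonneg (powerset_mono.2 hTT') fun S _ _ => hc0 S

/-- **Sahi 2008, Theorem 1** (square-free form).  For parameters `m_x ∈ [0,1]` and a `𝒞`-valued
function `G : 2^ι → ℝ[t_j : j ∈ κ]/(t_j²)` without constant terms, every coefficient of
`1 - ∏_{T} (1 - G(T))^{μ(T)}`, `μ` the product weight, is nonnegative.  (Sahi's statement is for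
`𝒞`-valued `F : 2^X → tℝ≥0[[t]]`; the square-free algebra replaces `ℝ[[t]]`, cf. the specialisation
`t_i = t^{k_i}` on p. 220.) [cite: Sahi2008, Thm. 1 (p. 210)] -/
theorem sahi2008_thm1 {κ : Type*} [DecidableEq κ] [Fintype κ] (m : ι → ℝ) (h0 : ∀ x, 0 ≤ m x)
    (h1 : ∀ x, m x ≤ 1) (G : Finset ι → SqFree κ ℝ) (hG0 : ∀ T, (G T).IsNil)
    (hG : ∀ τ, IsCumulation (fun T => (G T).coeff τ)) (τ : Finset κ) :
    0 ≤ (1 - ∏ T, binomB (finsetProdWeight m T) (G T)).coeff τ := by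
  have h := sahi2008_thm1_aux m h0 h1 univ G hG0 (fun τ' => (hG τ').isCumulOn univ) τ
  rwa [Finset.powerset_univ] at h

/-- **Sahi 2008, Proposition 12** for the product weight: `E_n(f) =` the top square-free coefficient
of `1 - ∏_T (1 - Σ_i t_i f_i(T))^{μ(T)}`. [cite: Sahi2008, Prop. 12 (p. 219)] -/
theorem sahi2008_prop12 (m : ι → ℝ) (n : ℕ) (f : Fin n → Finset ι → ℝ) :
    sahiE (finsetProdWeight m) n f = (1 - ∏ T, binomB (finsetProdWeight m T) (lin f T)).coeff univ :=
  sahiE_eq_gfE _ (sum_finsetProdWeight m) n f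

/-- **Sahi 2008, Theorem 2.**  For the product measure on `2^ι` with parameters `m_x ∈ [0,1]` and any
`n`-tuple `f_0, …, f_{n-1}` in the cumulation cone `𝒞` (nonnegative combinations of indicators of
principal up-sets), Sahi's higher correlation functional is nonnegative: `E_n(f_0,…,f_{n-1}) ≥ 0`.
This is the proved case, for every `n`, of Sahi's Conjecture 5. [cite: Sahi2008, Thm. 2 (p. 211);
proof p. 220 (from Thm. 1 and Prop. 12)] -/
theorem sahi2008_thm2 (m : ι → ℝ) (h0 : ∀ x, 0 ≤ m x) (h1 : ∀ x, m x ≤ 1) (n : ℕ)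
    (f : Fin n → Finset ι → ℝ) (hf : ∀ i, IsCumulation (f i)) :
    0 ≤ sahiE (finsetProdWeight m) n f := by
  rw [sahi2008_prop12]
  refine sahi2008_thm1 m h0 h1 (fun T => lin f T) (fun T => isNil_lin f T) (fun τ => ?_) univ
  simp only [lin, coeff_sum]
  have : ∀ i : Fin n, IsCumulation (fun T => (single {i} (f i T)).coeff τ) := by
    intro i
    by_cases h : τ = {i}
    · have e : (fun T => (single {i} (f i T)).coeff τ) = f i := by
        funext T; rw [coeff_single, if_pos h]
      rw [e]; exact hf i
    · have e : (fun T => (single {i} (f i T)).coeff τ) = fun _ => (0 : ℝ) := by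
        funext T; rw [coeff_single, if_neg h]
      rw [e]; exact ⟨fun _ => 0, fun _ => le_rfl, fun T => by simp⟩
  -- finite sums of cumulations
  have hs : ∀ s : Finset (Fin n), IsCumulation (fun T => ∑ i ∈ s, (single {i} (f i T)).coeff τ) := by
    intro s
    induction s using Finset.cons_induction with
    | empty => exact ⟨fun _ => 0, fun _ => le_rfl, fun T => by simp⟩
    | cons i s hi ih =>
      have := (this i).add ih
      simpa only [sum_cons] using this
  exact hs univ

end Main

/-! ### Transport along a relabelling of the lattice, and the `Set ι` form -/

section Transport

variable {α β : Type*} [Fintype α] [Fintype β]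

/-- `E_n` is invariant under relabelling the points of the lattice by a bijection. [cite: Sahi2008, §1 (p. 209)] -/
theorem sahiE_comp_equiv (e : β ≃ α) (μ : α → ℝ) :
    ∀ (n : ℕ) (f : Fin n → α → ℝ), sahiE (μ ∘ e) n (fun i => f i ∘ e) = sahiE μ n f
  | 0, f => rfl
  | 1, f => by
    rw [sahiE_one_apply, sahiE_one_apply, ex, ex]
    exact e.sum_comp (fun x => μ x * f 0 x)
  | n + 2, f => by
    rw [sahiE_succ_succ, sahiE_succ_succ]
    have ht : Fin.tail (fun i => f i ∘ e) = fun i => Fin.tail f i ∘ e := rfl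
    simp only [ht]
    have h0 : ex (μ ∘ e) (f 0 ∘ e) = ex μ (f 0) := by
      rw [ex, ex]; exact e.sum_comp (fun x => μ x * f 0 x)
    have hu : ∀ i : Fin (n + 1),
        Function.update (fun i => Fin.tail f i ∘ e) i ((Fin.tail f i ∘ e) * (f 0 ∘ e))
          = fun j => Function.update (Fin.tail f) i (Fin.tail f i * f 0) j ∘ e := by
      intro i
      funext j y
      by_cases hj : j = i
      · subst hj
        simp only [Function.update_self, Function.comp_apply, Pi.mul_apply]
      · simp only [Function.update_of_ne hj, Function.comp_apply]
    rw [h0, sahiE_comp_equiv e μ (n + 1) (Fin.tail f)]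
    congr 1
    refine Finset.sum_congr rfl fun i _ => ?_
    rw [hu i, sahiE_comp_equiv e μ (n + 1)]

end Transport

section SetForm

variable {ι : Type*} [DecidableEq ι] [Fintype ι]

/-- **Sahi 2008, Theorem 2** on the lattice `Set ι` with the product weight
`Literature.Probability.Percolation.BHK2006.weight m` (the form used by the percolation files):
`E_n(f_0,…,f_{n-1}) ≥ 0` for every `n` whenever each `f_i` is a cumulation, i.e.
`f_i(T) = Σ_{S ⊆ T} c_i(S)` with `c_i ≥ 0` (stated through the bijection `Finset ι ≃ Set ι`).
[cite: Sahi2008, Thm. 2 (p. 211)] -/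
theorem sahi2008_thm2_set (m : ι → ℝ) (h0 : ∀ x, 0 ≤ m x) (h1 : ∀ x, m x ≤ 1) (n : ℕ)
    (f : Fin n → Set ι → ℝ)
    (hf : ∀ i, ∃ c : Finset ι → ℝ, (∀ S, 0 ≤ c S) ∧ ∀ T : Finset ι, f i ↑T = ∑ S ∈ T.powerset, c S) :
    0 ≤ sahiE (Literature.Probability.Percolation.BHK2006.weight m) n f := by
  classical
  let e : Finset ι ≃ Set ι := Fintype.finsetEquivSet
  have he : ∀ T : Finset ι, e T = ↑T := fun T => Fintype.finsetEquivSet_apply T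
  have hw : ∀ T : Finset ι,
      Literature.Probability.Percolation.BHK2006.weight m (e T) = finsetProdWeight m T := by
    intro T
    unfold Literature.Probability.Percolation.BHK2006.weight finsetProdWeight
    refine Finset.prod_congr rfl fun x _ => ?_
    have hx : (x ∈ e T) ↔ x ∈ T := by rw [he T]; exact Finset.mem_coe
    by_cases h : x ∈ T
    · rw [if_pos (hx.2 h), if_pos h]
    · rw [if_neg (fun h' => h (hx.1 h')), if_neg h]
  have hw' : (Literature.Probability.Percolation.BHK2006.weight m) ∘ e = finsetProdWeight m := funext hw
  rw [← sahiE_comp_equiv e, hw']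
  refine sahi2008_thm2 m h0 h1 n (fun i => f i ∘ e) fun i => ?_
  obtain ⟨c, hc0, hc⟩ := hf i
  exact ⟨c, hc0, fun T => by rw [Function.comp_apply, he T]; exact hc T⟩

end SetForm

/-! ### Sahi's Lemma 8 / Corollary 9: Möbius inversion and the membership test for `𝒞` -/

section Mobius

variable {ι : Type*} [DecidableEq ι]

/-- Sahi's `F⁻`, the Möbius inverse on the Boolean lattice:
`F⁻(U) = Σ_{S ⊆ U} (-1)^{|U ∖ S|} F(S)` (`= δ_U F(∅)`). [cite: Sahi2008, Lemma 8 (p. 216)] -/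
def mobiusInv (g : Finset ι → ℝ) (U : Finset ι) : ℝ :=
  ∑ S ∈ U.powerset, (-1 : ℝ) ^ (U \ S).card * g S

/-- `Σ_{W ⊆ D} (-1)^{|W|} = [D = ∅]` over `ℝ`. [folklore] -/
private theorem sum_powerset_neg_one_pow_card_real (D : Finset ι) :
    ∑ W ∈ D.powerset, (-1 : ℝ) ^ W.card = if D = ∅ then 1 else 0 := by
  have h := Finset.sum_powerset_neg_one_pow_card (x := D)
  have h' := congrArg (fun z : ℤ => (z : ℝ)) h
  simp only [Int.cast_sum, Int.cast_pow, Int.cast_neg, Int.cast_one] at h'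
  rw [h']; split_ifs <;> simp

/-- `Σ_{W ⊆ D} (-1)^{|D ∖ W|} = [D = ∅]`. [folklore] -/
private theorem sum_powerset_neg_one_pow_card_sdiff (D : Finset ι) :
    ∑ W ∈ D.powerset, (-1 : ℝ) ^ (D \ W).card = if D = ∅ then 1 else 0 := by
  have e : ∑ W ∈ D.powerset, (-1 : ℝ) ^ (D \ W).card = ∑ W ∈ D.powerset, (-1 : ℝ) ^ W.card := by
    refine Finset.sum_nbij' (fun W => D \ W) (fun W => D \ W) ?_ ?_ ?_ ?_ ?_
    · intro W _; exact mem_powerset.2 sdiff_subset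
    · intro W _; exact mem_powerset.2 sdiff_subset
    · intro W hW; exact Finset.sdiff_sdiff_eq_self (mem_powerset.1 hW)
    · intro W hW; exact Finset.sdiff_sdiff_eq_self (mem_powerset.1 hW)
    · intro W _; rfl
  rw [e]; exact sum_powerset_neg_one_pow_card_real D

/-- The interval sum `Σ_{V ⊆ S ⊆ U} (-1)^{|U ∖ S|} = [V = U]` (for `V ⊆ U`). [folklore] -/
private theorem sum_interval_neg_one_pow (V U : Finset ι) (hVU : V ⊆ U) :
    ∑ S ∈ U.powerset.filter (fun S => V ⊆ S), (-1 : ℝ) ^ (U \ S).card = if V = U then 1 else 0 := by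
  have key : ∑ S ∈ U.powerset.filter (fun S => V ⊆ S), (-1 : ℝ) ^ (U \ S).card
      = ∑ W ∈ (U \ V).powerset, (-1 : ℝ) ^ ((U \ V) \ W).card := by
    refine Finset.sum_nbij' (fun S => S \ V) (fun W => V ∪ W) ?_ ?_ ?_ ?_ ?_
    · intro S hS
      simp only [mem_filter, mem_powerset] at hS
      exact mem_powerset.2 (sdiff_subset_sdiff hS.1 le_rfl)
    · intro W hW
      rw [mem_powerset] at hW
      simp only [mem_filter, mem_powerset]
      exact ⟨union_subset hVU (hW.trans sdiff_subset), subset_union_left⟩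
    · intro S hS
      simp only [mem_filter, mem_powerset] at hS
      exact union_sdiff_of_subset hS.2
    · intro W hW
      rw [mem_powerset] at hW
      rw [Finset.union_sdiff_left, Finset.sdiff_eq_self_iff_disjoint]
      exact Finset.sdiff_disjoint.mono_left hW
    · intro S hS
      simp only [mem_filter, mem_powerset] at hS
      rw [SqFree.sdiff_sdiff_sdiff_of_subset hS.2]
  rw [key, sum_powerset_neg_one_pow_card_sdiff]
  by_cases h : V = U
  · subst h; simp
  · rw [if_neg, if_neg h]
    intro hUV
    apply h
    exact Subset.antisymm hVU (sdiff_eq_empty_iff_subset.1 hUV)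

/-- **Sahi 2008, Lemma 8** (`(F⁺)⁻ = F`): the Möbius inverse of a cumulation recovers the coefficients.
[cite: Sahi2008, Lemma 8 (p. 216)] -/
theorem mobiusInv_cumul (c : Finset ι → ℝ) (U : Finset ι) :
    mobiusInv (fun T => ∑ S ∈ T.powerset, c S) U = c U := by
  unfold mobiusInv
  simp only [mul_sum]
  rw [Finset.sum_comm' (t' := U.powerset) (s' := fun V => U.powerset.filter (fun S => V ⊆ S))]
  · have : ∀ V ∈ U.powerset, ∑ S ∈ U.powerset.filter (fun S => V ⊆ S), (-1 : ℝ) ^ (U \ S).card * c V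
        = (if V = U then 1 else 0) * c V := by
      intro V hV
      rw [← sum_mul, sum_interval_neg_one_pow V U (mem_powerset.1 hV)]
    rw [sum_congr rfl this]
    simp_rw [boole_mul]
    rw [Finset.sum_ite_eq', if_pos (mem_powerset.2 (subset_refl U))]
  · intro S V
    simp only [mem_powerset, mem_filter]
    constructor
    · rintro ⟨hSU, hVS⟩; exact ⟨⟨hSU, hVS⟩, hVS.trans hSU⟩
    · rintro ⟨⟨hSU, hVS⟩, _⟩; exact ⟨hSU, hVS⟩

/-- **Sahi 2008, Lemma 8** (`(F⁻)⁺ = F`): every set function is the cumulation of its Möbius inverse.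
[cite: Sahi2008, Lemma 8 (p. 216)] -/
theorem cumul_mobiusInv (g : Finset ι → ℝ) (T : Finset ι) :
    ∑ U ∈ T.powerset, mobiusInv g U = g T := by
  unfold mobiusInv
  rw [Finset.sum_comm' (t' := T.powerset) (s' := fun S => T.powerset.filter (fun U => S ⊆ U))]
  · have : ∀ S ∈ T.powerset, ∑ U ∈ T.powerset.filter (fun U => S ⊆ U), (-1 : ℝ) ^ (U \ S).card * g S
        = (if S = T then 1 else 0) * g S := by
      intro S hS
      rw [← sum_mul]
      congr 1
      have key : ∑ U ∈ T.powerset.filter (fun U => S ⊆ U), (-1 : ℝ) ^ (U \ S).card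
          = ∑ W ∈ (T \ S).powerset, (-1 : ℝ) ^ W.card := by
        refine Finset.sum_nbij' (fun U => U \ S) (fun W => S ∪ W) ?_ ?_ ?_ ?_ ?_
        · intro U hU
          simp only [mem_filter, mem_powerset] at hU
          exact mem_powerset.2 (sdiff_subset_sdiff hU.1 le_rfl)
        · intro W hW
          rw [mem_powerset] at hW
          simp only [mem_filter, mem_powerset]
          exact ⟨union_subset (mem_powerset.1 hS) (hW.trans sdiff_subset), subset_union_left⟩
        · intro U hU
          simp only [mem_filter, mem_powerset] at hU
          exact union_sdiff_of_subset hU.2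
        · intro W hW
          rw [mem_powerset] at hW
          rw [Finset.union_sdiff_left, Finset.sdiff_eq_self_iff_disjoint]
          exact Finset.sdiff_disjoint.mono_left hW
        · intro U _; rfl
      rw [key, sum_powerset_neg_one_pow_card_real]
      by_cases h : S = T
      · subst h; simp
      · rw [if_neg, if_neg h]
        intro hTS; apply h
        exact Subset.antisymm (mem_powerset.1 hS) (sdiff_eq_empty_iff_subset.1 hTS)
    rw [sum_congr rfl this]
    simp_rw [boole_mul]
    rw [Finset.sum_ite_eq', if_pos (mem_powerset.2 (subset_refl T))]
  · intro U S
    simp only [mem_powerset, mem_filter]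
    constructor
    · rintro ⟨hUT, hSU⟩; exact ⟨⟨hUT, hSU⟩, hSU.trans hUT⟩
    · rintro ⟨⟨hUT, hSU⟩, _⟩; exact ⟨hUT, hSU⟩

/-- **Sahi 2008, Corollary 9**: `F ∈ 𝒞[X] ⟺ F⁻ ≥ 0` — a decidable membership test for the
cumulation cone. [cite: Sahi2008, Cor. 9 (p. 216)] -/
theorem isCumulation_iff_mobiusInv_nonneg (g : Finset ι → ℝ) :
    IsCumulation g ↔ ∀ U, 0 ≤ mobiusInv g U := by
  constructor
  · rintro ⟨c, hc0, hc⟩ U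
    have hg : g = fun T => ∑ S ∈ T.powerset, c S := funext hc
    rw [hg, mobiusInv_cumul]
    exact hc0 U
  · intro h
    exact ⟨mobiusInv g, h, fun T => (cumul_mobiusInv g T).symm⟩

/-- **Sahi 2008, Theorem 2** for indicators of principal up-sets (cylinder events "all points of
`S_i` present"): `E_n(1_{↑S_0}, …, 1_{↑S_{n-1}}) ≥ 0` under every product measure.
[cite: Sahi2008, Thm. 2 (p. 211)] -/
theorem sahi2008_thm2_indicator [Fintype ι] (m : ι → ℝ) (h0 : ∀ x, 0 ≤ m x) (h1 : ∀ x, m x ≤ 1) {n : ℕ}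
    (S : Fin n → Finset ι) :
    0 ≤ sahiE (finsetProdWeight m) n (fun i T => if S i ⊆ T then (1 : ℝ) else 0) :=
  sahi2008_thm2 m h0 h1 n _ fun i => isCumulation_indicator_supset (S i)

end Mobius

/-! ## Part G.  Proposition 15 (`|X| ≤ 2`, every FKG weight, every `n`): the core of Lemma 16 in the
square-free algebra, in EVENT form

[Sahi2008, Prop. 15 (p. 222), proof pp. 222–226 with Lemmas 14 and 16.]  After the layer cake (Lemma 14:
a nonnegative monotone function on `2^{{1,2}}` is `a·1 + b·1_{≠∅} + c·1_{∋1} + d·1_{∋2} + e·1_{={1,2}}` with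
`a,…,e ≥ 0`) and Proposition 12, Sahi has to show that every coefficient of
`1 − Π`, `Π = (1−a)^δ (1−a−b−c)^γ (1−a−b−d)^β (1−a−b−c−d−e)^α` (`δ, γ, β, α` the weights of
`∅, {1}, {2}, {1,2}`; `α+β+γ+δ = 1`, `αδ ≥ βγ`) is nonnegative [Lemma 16].  The reductions to `a = 0`
and `b = 0` (p. 224–225) are, in the language of `E_n`, the peeling of slots holding the constant `1`
[Thm. 6] and of absorbing slots [LiebSahi2021, Lemma 3.2]; they are carried out measure-side in
`Sahi2008/ProvedCases.lean`.  The CORE (`a = b = 0`, p. 225–226) is reproduced here verbatim in the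
square-free algebra: with `c, d, e` the sums of the variables of three disjoint blocks,
`(1−c−d−e)^α = (1−c)^α (1−d)^α (1 − (cd+e)/((1−c)(1−d)))^α`, the binomial expansion of the last factor
(terms `k ≥ 2` and the `e`-terms are nonnegative), and the comparison of the `c^k d^l` coefficients of
`(1−c)^{α+γ}(1−d)^{α+β}` and `α·cd·(1−c)^{α+γ−1}(1−d)^{α+β−1}`, which is `α k l ≥ (α+γ)(α+β)`, i.e. for
`k = l = 1` Sahi's `(α+γ)(α+β) = α(α+β+γ) + βγ ≤ α(α+β+γ) + αδ = α`.  Read through Proposition 12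
(`sahiE_eq_gfE`) the core says: for ANY probability weight on a finite set and two `{0,1}`-valued
functions `g₁, g₂` with `E(g₁)E(g₂) ≤ E(g₁g₂)` (the one place where the FKG hypothesis enters:
`(α+β)(α+γ) ≤ α`), `E_n ≥ 0` on every `n`-tuple drawn from `{g₁, g₂, g₁g₂}`
(`sahiE_nonneg_of_corrPair_labels`). -/

section RChSign

/-- `C(m, k+1) = C(m, k)·(m − k)/(k + 1)` over `ℝ`. [folklore] -/
private theorem rch_succ_real (k : ℕ) (m : ℝ) :
    rch (k + 1) m = rch k m * (m - (k : ℝ)) / ((k : ℝ) + 1) := by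
  rw [rch_real, rch_real, descPochhammer_succ_eval, Nat.factorial_succ k]
  have h1 : ((k.factorial : ℕ) : ℝ) ≠ 0 := by positivity
  have h2 : ((k : ℝ) + 1) ≠ 0 := by positivity
  push_cast
  field_simp

/-- For `s ≤ 0` every coefficient of `(1-u)^s = Σ_k C(s,k)(−u)^k` is nonnegative:
`(−1)^k C(s,k) = (−s)(1−s)⋯(k−1−s)/k! ≥ 0`. [cite: Sahi2008, proof of Lemma 16 (p. 224):
"by the binomial theorem the expansion of `1/(1−a)^{j+k+l+m−1}` has only positive terms"] -/
theorem neg_one_pow_mul_rch_nonneg_of_nonpos {s : ℝ} (hs : s ≤ 0) (k : ℕ) :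
    0 ≤ (-1 : ℝ) ^ k * rch k s := by
  induction k with
  | zero => simp [rch_zero]
  | succ k ih =>
    have e : (-1 : ℝ) ^ (k + 1) * rch (k + 1) s
        = ((-1) ^ k * rch k s) * ((((k : ℝ) - s)) / ((k : ℝ) + 1)) := by
      rw [rch_succ_real]; ring
    rw [e]
    refine mul_nonneg ih (div_nonneg ?_ (by positivity))
    have : (0 : ℝ) ≤ k := Nat.cast_nonneg k
    linarith

end RChSign

namespace SqFree

section PartG

variable {κ : Type*} [DecidableEq κ]

/-! ### Elements with nonnegative coefficients (Sahi's cone `𝒫`, square-free form) -/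

/-- All square-free coefficients of `a` are nonnegative — the square-free form of Sahi's cone `𝒫` of
power series with nonnegative coefficients. [cite: Sahi2008, p. 210 (the cone 𝒫)] -/
def Nonneg (a : SqFree κ ℝ) : Prop := ∀ τ, 0 ≤ a.coeff τ

namespace Nonneg

omit [DecidableEq κ] in
/-- `0 ∈ 𝒫`. [folklore] -/
private theorem zero : (0 : SqFree κ ℝ).Nonneg := fun _ => le_rfl

/-- `1 ∈ 𝒫`. [folklore] -/
private theorem one : (1 : SqFree κ ℝ).Nonneg := fun τ => by
  rw [coeff_one]; split_ifs <;> norm_num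

omit [DecidableEq κ] in
/-- `𝒫` is closed under addition. [folklore] -/
private theorem add {a b : SqFree κ ℝ} (ha : a.Nonneg) (hb : b.Nonneg) : (a + b).Nonneg :=
  fun τ => by rw [coeff_add]; exact add_nonneg (ha τ) (hb τ)

/-- `𝒫` is closed under multiplication. [folklore] -/
private theorem mul {a b : SqFree κ ℝ} (ha : a.Nonneg) (hb : b.Nonneg) : (a * b).Nonneg :=
  fun τ => by
    rw [coeff_mul]
    exact Finset.sum_nonneg fun σ _ => mul_nonneg (ha σ) (hb _)

/-- `𝒫` is closed under finite sums. [folklore] -/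
private theorem sum {β : Type*} {s : Finset β} {g : β → SqFree κ ℝ} (h : ∀ x ∈ s, (g x).Nonneg) :
    (∑ x ∈ s, g x).Nonneg := fun τ => by
  rw [coeff_sum]
  exact Finset.sum_nonneg fun x hx => h x hx τ

/-- `𝒫` is closed under finite products. [folklore] -/
private theorem prod {β : Type*} {s : Finset β} {g : β → SqFree κ ℝ} (h : ∀ x ∈ s, (g x).Nonneg) :
    (∏ x ∈ s, g x).Nonneg := by
  induction s using Finset.cons_induction with
  | empty => rw [Finset.prod_empty]; exact one
  | cons x s hx ih =>
    rw [Finset.prod_cons]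
    exact (h x (Finset.mem_cons_self x s)).mul (ih fun y hy => h y (Finset.mem_cons_of_mem hy))

/-- `𝒫` is closed under powers. [folklore] -/
private theorem pow {a : SqFree κ ℝ} (ha : a.Nonneg) : ∀ k : ℕ, (a ^ k).Nonneg
  | 0 => by rw [pow_zero]; exact one
  | k + 1 => by rw [pow_succ]; exact (pow ha k).mul ha

/-- Nonnegative constants lie in `𝒫`. [folklore] -/
private theorem C {r : ℝ} (hr : 0 ≤ r) : (C r : SqFree κ ℝ).Nonneg := fun τ => by
  rw [coeff_C]; split_ifs <;> [exact hr; exact le_rfl]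

/-- A nonnegative constant multiple of an element of `𝒫` lies in `𝒫`. [folklore] -/
private theorem C_mul {r : ℝ} (hr : 0 ≤ r) {a : SqFree κ ℝ} (ha : a.Nonneg) : (SqFree.C r * a).Nonneg :=
  (C hr).mul ha

/-- Monomials with nonnegative coefficient lie in `𝒫`. [folklore] -/
private theorem single (σ : Finset κ) {r : ℝ} (hr : 0 ≤ r) : (single σ r).Nonneg := fun τ => by
  rw [coeff_single]; split_ifs <;> [exact hr; exact le_rfl]

/-- `(1-u)⁻¹ = Σ u^j ∈ 𝒫` for `u ∈ 𝒫`. [folklore] -/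
private theorem inv1 [Fintype κ] {u : SqFree κ ℝ} (hu : u.Nonneg) : (inv1 u).Nonneg :=
  sum fun j _ => hu.pow j

/-- For an exponent `s ≤ 0` and `u ∈ 𝒫` without constant term, `(1-u)^s ∈ 𝒫`
("the expansion of `1/(1−a)^{j+k+l+m−1}` has only positive terms").
[cite: Sahi2008, proof of Lemma 16 (p. 224)] -/
theorem binomB_of_nonpos [Fintype κ] {s : ℝ} (hs : s ≤ 0) {u : SqFree κ ℝ} (hu : u.Nonneg) :
    (binomB s u).Nonneg := by
  rw [binomB]
  refine sum fun k _ => ?_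
  have e : (-u) ^ k = SqFree.C ((-1 : ℝ) ^ k) * u ^ k := by
    rw [neg_pow, map_pow, map_neg, map_one]
  have hc : 0 ≤ rch k s * (-1 : ℝ) ^ k := by
    rw [mul_comm]; exact neg_one_pow_mul_rch_nonneg_of_nonpos hs k
  rw [e, ← mul_assoc, ← map_mul]
  exact (C hc).mul (hu.pow k)

/-- For an exponent `0 ≤ s ≤ 1` and `u ∈ 𝒫`, `1 − (1-u)^s = Σ_{k≥1} (−1)^{k−1}C(s,k) u^k ∈ 𝒫`
("since `0 ≤ α+β+γ ≤ 1`, by the binomial theorem `(1−b)^{α+β+γ} = 1 −` (non-negative terms)").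
[cite: Sahi2008, proof of Lemma 16 (p. 225)] -/
theorem one_sub_binomB_of_unit [Fintype κ] {s : ℝ} (h0 : 0 ≤ s) (h1 : s ≤ 1) {u : SqFree κ ℝ}
    (hu : u.Nonneg) : (1 - binomB s u).Nonneg := by
  rw [binomB_eq_one_sub, sub_sub_cancel]
  exact sum fun k _ => (C (neg_one_pow_mul_rch_succ_nonneg h0 h1 k)).mul (hu.pow (k + 1))

end Nonneg

/-! ### Elements involving only the variables of a block -/

/-- `a` involves only the variables `t_i`, `i ∈ K` (plumbing predicate). [folklore] -/
private def PureOn (K : Finset κ) (a : SqFree κ ℝ) : Prop := ∀ τ, ¬ τ ⊆ K → a.coeff τ = 0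

namespace PureOn

variable {K : Finset κ}

/-- `1` involves no variables. [folklore] -/
private theorem one : (1 : SqFree κ ℝ).PureOn K := fun τ hτ => by
  rw [coeff_one, if_neg]
  rintro rfl; exact hτ (Finset.empty_subset K)

omit [DecidableEq κ] in
/-- `0` involves no variables. [folklore] -/
private theorem zero : (0 : SqFree κ ℝ).PureOn K := fun _ _ => rfl

/-- Constants involve no variables. [folklore] -/
private theorem C (r : ℝ) : (C r : SqFree κ ℝ).PureOn K := fun τ hτ => by
  rw [coeff_C, if_neg]
  rintro rfl; exact hτ (Finset.empty_subset K)

/-- A monomial on `K` involves only the variables of `K`. [folklore] -/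
private theorem single {σ : Finset κ} (hσ : σ ⊆ K) (r : ℝ) : (single σ r).PureOn K := fun τ hτ => by
  rw [coeff_single, if_neg]
  rintro rfl; exact hτ hσ

omit [DecidableEq κ] in
/-- Closure under addition. [folklore] -/
private theorem add {a b : SqFree κ ℝ} (ha : a.PureOn K) (hb : b.PureOn K) : (a + b).PureOn K :=
  fun τ hτ => by rw [coeff_add, ha τ hτ, hb τ hτ, add_zero]

omit [DecidableEq κ] in
/-- Closure under subtraction. [folklore] -/
private theorem sub {a b : SqFree κ ℝ} (ha : a.PureOn K) (hb : b.PureOn K) : (a - b).PureOn K :=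
  fun τ hτ => by rw [coeff_sub, ha τ hτ, hb τ hτ, sub_zero]

omit [DecidableEq κ] in
/-- Closure under negation. [folklore] -/
private theorem neg {a : SqFree κ ℝ} (ha : a.PureOn K) : (-a).PureOn K :=
  fun τ hτ => by rw [coeff_neg, ha τ hτ, neg_zero]

/-- Closure under multiplication. [folklore] -/
private theorem mul {a b : SqFree κ ℝ} (ha : a.PureOn K) (hb : b.PureOn K) : (a * b).PureOn K := by
  intro τ hτ
  rw [coeff_mul]
  refine Finset.sum_eq_zero fun σ hσ => ?_
  have hστ : σ ⊆ τ := Finset.mem_powerset.1 hσ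
  by_cases hσK : σ ⊆ K
  · have : ¬ τ \ σ ⊆ K := by
      intro h
      exact hτ (fun i hi => by
        by_cases hiσ : i ∈ σ
        · exact hσK hiσ
        · exact h (Finset.mem_sdiff.2 ⟨hi, hiσ⟩))
    rw [hb _ this, mul_zero]
  · rw [ha σ hσK, zero_mul]

/-- Closure under finite sums. [folklore] -/
private theorem sum {β : Type*} {s : Finset β} {g : β → SqFree κ ℝ} (h : ∀ x ∈ s, (g x).PureOn K) :
    (∑ x ∈ s, g x).PureOn K := fun τ hτ => by
  rw [coeff_sum]
  exact Finset.sum_eq_zero fun x hx => h x hx τ hτ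

/-- Closure under powers. [folklore] -/
private theorem pow {a : SqFree κ ℝ} (ha : a.PureOn K) : ∀ k : ℕ, (a ^ k).PureOn K
  | 0 => by rw [pow_zero]; exact one
  | k + 1 => by rw [pow_succ]; exact (pow ha k).mul ha

/-- Closure under `(1-u)⁻¹`. [folklore] -/
private theorem inv1 [Fintype κ] {u : SqFree κ ℝ} (hu : u.PureOn K) : (inv1 u).PureOn K :=
  sum fun j _ => hu.pow j

/-- Closure under binomial powers. [folklore] -/
private theorem binomB [Fintype κ] (s : ℝ) {u : SqFree κ ℝ} (hu : u.PureOn K) : (binomB s u).PureOn K :=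
  sum fun k _ => (C _).mul (hu.neg.pow k)

end PureOn

/-- **Coefficients of a product of elements on DISJOINT blocks**: the coefficient of `t^τ` in `a·b`,
`a` on `K`, `b` on `L`, `K ∩ L = ∅`, is `a_{τ∩K} · b_{τ∖K}` (and `0` unless `τ ⊆ K ∪ L`).
[folklore] -/
private theorem coeff_mul_of_pureOn {K L : Finset κ} (hKL : Disjoint K L) {a b : SqFree κ ℝ}
    (ha : a.PureOn K) (hb : b.PureOn L) (τ : Finset κ) :
    (a * b).coeff τ = if τ ⊆ K ∪ L then a.coeff (τ ∩ K) * b.coeff (τ \ K) else 0 := by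
  rw [coeff_mul]
  split_ifs with hτ
  · rw [Finset.sum_eq_single (τ ∩ K)]
    · rw [Finset.sdiff_inter_self_left]
    · intro σ hσ hne
      have hστ : σ ⊆ τ := Finset.mem_powerset.1 hσ
      by_cases hσK : σ ⊆ K
      · -- then some `i ∈ τ ∩ K` is missing from `σ`, and it lies in `τ \ σ` but not in `L`
        have : ¬ τ \ σ ⊆ L := by
          intro h
          apply hne
          refine Finset.Subset.antisymm (Finset.subset_inter hστ hσK) fun i hi => ?_
          by_contra hiσ
          have hiL : i ∈ L := h (Finset.mem_sdiff.2 ⟨(Finset.mem_inter.1 hi).1, hiσ⟩)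
          exact Finset.disjoint_left.1 hKL (Finset.mem_inter.1 hi).2 hiL
        rw [hb _ this, mul_zero]
      · rw [ha σ hσK, zero_mul]
    · intro h
      exact absurd (Finset.mem_powerset.2 Finset.inter_subset_left) h
  · refine Finset.sum_eq_zero fun σ hσ => ?_
    have hστ : σ ⊆ τ := Finset.mem_powerset.1 hσ
    by_cases hσK : σ ⊆ K
    · have : ¬ τ \ σ ⊆ L := by
        intro h
        apply hτ
        intro i hi
        by_cases hiσ : i ∈ σ
        · exact Finset.mem_union_left _ (hσK hiσ)
        · exact Finset.mem_union_right _ (h (Finset.mem_sdiff.2 ⟨hi, hiσ⟩))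
      rw [hb _ this, mul_zero]
    · rw [ha σ hσK, zero_mul]

/-- Comparison of two block products coefficient by coefficient: if `p_σ q_ρ ≤ x_σ y_ρ` for all
`σ ⊆ K`, `ρ ⊆ L` (`x, p` on `K`; `y, q` on `L`; blocks disjoint) then `x·y − p·q ∈ 𝒫`.
[folklore] -/
private theorem nonneg_mul_sub_mul_of_pureOn {K L : Finset κ} (hKL : Disjoint K L)
    {x p y q : SqFree κ ℝ} (hx : x.PureOn K) (hp : p.PureOn K) (hy : y.PureOn L) (hq : q.PureOn L)
    (h : ∀ σ, σ ⊆ K → ∀ ρ, ρ ⊆ L → p.coeff σ * q.coeff ρ ≤ x.coeff σ * y.coeff ρ) :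
    (x * y - p * q).Nonneg := by
  intro τ
  rw [coeff_sub, coeff_mul_of_pureOn hKL hx hy, coeff_mul_of_pureOn hKL hp hq]
  split_ifs with hτ
  · refine sub_nonneg.2 (h _ Finset.inter_subset_right _ fun i hi => ?_)
    have hi' := Finset.mem_sdiff.1 hi
    rcases Finset.mem_union.1 (hτ hi'.1) with hK | hL
    · exact absurd hK hi'.2
    · exact hL
  · simp

/-! ### Block sums of variables -/

variable [Fintype κ]

/-- The block sum `T_j = Σ_{i : lab i = j} t_i` of the variables labelled `j`. [folklore] -/
def bsum (lab : κ → Fin 3) (j : Fin 3) : SqFree κ ℝ := ∑ i, if lab i = j then single {i} 1 else 0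

/-- A block sum has no constant term. [folklore] -/
private theorem isNil_bsum (lab : κ → Fin 3) (j : Fin 3) : (bsum lab j).IsNil :=
  IsNil.sum fun i _ => by
    split_ifs
    · exact isNil_single (Finset.singleton_nonempty i) _
    · exact IsNil.zero

/-- A block sum has nonnegative coefficients. [folklore] -/
private theorem nonneg_bsum (lab : κ → Fin 3) (j : Fin 3) : (bsum lab j).Nonneg :=
  Nonneg.sum fun i _ => by
    split_ifs
    · exact Nonneg.single _ zero_le_one
    · exact Nonneg.zero

/-- A block sum involves only the variables of its block. [folklore] -/
private theorem pureOn_bsum (lab : κ → Fin 3) (j : Fin 3) :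
    (bsum lab j).PureOn (Finset.univ.filter fun i => lab i = j) :=
  PureOn.sum fun i _ => by
    split_ifs with h
    · exact PureOn.single (Finset.singleton_subset_iff.2 (Finset.mem_filter.2 ⟨Finset.mem_univ i, h⟩)) _
    · exact PureOn.zero

/-- A block sum is homogeneous of degree one: `D T_j = T_j`. [folklore] -/
private theorem D_bsum (lab : κ → Fin 3) (j : Fin 3) : D (bsum lab j) = bsum lab j := by
  rw [bsum, D_sum]
  refine Finset.sum_congr rfl fun i _ => ?_
  split_ifs
  · rw [D_single, Finset.card_singleton, Nat.cast_one, map_one, one_mul]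
  · ext τ; simp

/-! ### Binomial-power identities used in the core -/

/-- `(1 - 0)^c = 1`. [folklore] -/
private theorem binomB_zero_right (c : ℝ) : binomB c (0 : SqFree κ ℝ) = 1 := by
  rw [binomB, Finset.sum_range_succ']
  have : ∀ k ∈ Finset.range (Fintype.card κ),
      (SqFree.C (rch (k + 1) c) : SqFree κ ℝ) * (-0) ^ (k + 1) = 0 := by
    intro k _; rw [neg_zero, zero_pow (Nat.succ_ne_zero k), mul_zero]
  rw [Finset.sum_eq_zero this]
  simp [rch_zero]

/-- `(1-u)^{c-k} = (1-u)^c (1-u)^{-k}` for natural `k`. [folklore] -/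
private theorem binomB_sub_natCast {u : SqFree κ ℝ} (hu : u.IsNil) (c : ℝ) :
    ∀ k : ℕ, binomB (c - k) u = binomB c u * inv1 u ^ k
  | 0 => by rw [Nat.cast_zero, sub_zero, pow_zero, mul_one]
  | k + 1 => by
    have e : c - ((k + 1 : ℕ) : ℝ) = (c - k) - 1 := by push_cast; ring
    rw [e, binomB_sub_one hu, binomB_sub_natCast hu c k, pow_succ, mul_assoc]

/-- Additivity of the exponent over a finite product: `∏_x (1-u)^{c_x} = (1-u)^{Σ c_x}`.
[folklore] -/
private theorem prod_binomB_eq_binomB_sum {β : Type*} (s : Finset β) (c : β → ℝ) {u : SqFree κ ℝ}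
    (hu : u.IsNil) : ∏ x ∈ s, binomB (c x) u = binomB (∑ x ∈ s, c x) u := by
  induction s using Finset.cons_induction with
  | empty => rw [Finset.prod_empty, Finset.sum_empty, binomB_zero_left]
  | cons x s hx ih => rw [Finset.prod_cons, Finset.sum_cons, ih, binomB_mul_binomB_same hu]

/-- **Sahi's rewriting of the last factor** (p. 225):
`(1 − c − d − e)^α = (1−c)^α (1−d)^α (1 − (cd + e)/((1−c)(1−d)))^α`. [cite: Sahi2008, proof of
Lemma 16 (p. 225)] -/
theorem binomB_add_add_eq_mul {c d e : SqFree κ ℝ} (hc : c.IsNil) (hd : d.IsNil) (he : e.IsNil)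
    (a : ℝ) :
    binomB a (c + d + e)
      = binomB a c * binomB a d * binomB a ((c * d + e) * inv1 c * inv1 d) := by
  set w : SqFree κ ℝ := (c * d + e) * inv1 c * inv1 d with hw_def
  have hcd : (c + d - c * d).IsNil := (hc.add hd).sub (hc.mul_left d)
  have hcde : (c * d + e).IsNil := (hc.mul_left d).add he
  have hw : w.IsNil := (hcde.mul_left _).mul_left _
  have h1 : inv1 c * (1 - c) = 1 := inv1_mul_one_sub hc
  have h2 : inv1 d * (1 - d) = 1 := inv1_mul_one_sub hd
  have key : (c + d - c * d) + w - (c + d - c * d) * w = c + d + e := by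
    have : (c + d - c * d) * w = w - (c * d + e) := by
      rw [hw_def]
      linear_combination (-(c * d + e) * (inv1 d * (1 - d))) * h1 - (c * d + e) * h2
    rw [this]; ring
  symm
  calc binomB a c * binomB a d * binomB a w
      = binomB a (c + d - c * d) * binomB a w := by rw [binomB_mul_binomB hc hd]
    _ = binomB a ((c + d - c * d) + w - (c + d - c * d) * w) := binomB_mul_binomB hcd hw a
    _ = binomB a (c + d + e) := by rw [key]

/-! ### The core of Lemma 16 (`a = b = 0`) -/

/-- **Sahi 2008, Lemma 16 — the core case `a = b = 0`, square-free form.**  Let `c, d, e` be the sums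
of the variables of three disjoint blocks and `α, β, γ ≥ 0` with `α + β + γ ≤ 1` and
`(α + β)(α + γ) ≤ α` (Sahi: `α + β + γ + δ = 1`, `αδ ≥ βγ`).  Then every coefficient of
`1 − (1−c)^γ (1−d)^β (1−c−d−e)^α` is nonnegative.  Proof verbatim from p. 225–226:
`(1−c−d−e)^α = (1−c)^α(1−d)^α(1−w)^α`, `w = (cd+e)/((1−c)(1−d))`; in
`1 − (1−c)^{α+γ}(1−d)^{α+β}(1−w)^α` the terms of `1 − (1−w)^α = Σ_{k≥1} (−1)^{k−1}C(α,k) w^k`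
multiplied out are nonnegative, and the `cd`-part of the `k = 1` term,
`α·cd·(1−c)^{α+γ−1}(1−d)^{α+β−1}`, dominates `(1 − (1−c)^{α+γ})(1 − (1−d)^{α+β})` coefficient by
coefficient because `α k l ≥ (α+γ)(α+β)` for `k, l ≥ 1`.
[cite: Sahi2008, Lemma 16 (p. 223) and its proof, pp. 225–226] -/
theorem nonneg_one_sub_core (lab : κ → Fin 3) {α β γ : ℝ} (hα : 0 ≤ α) (hβ : 0 ≤ β) (hγ : 0 ≤ γ)
    (hsum : α + β + γ ≤ 1) (hcorr : (α + β) * (α + γ) ≤ α) :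
    (1 - binomB γ (bsum lab 0) * binomB β (bsum lab 1)
      * binomB α (bsum lab 0 + bsum lab 1 + bsum lab 2)).Nonneg := by
  -- the three block sums
  have hcN : (bsum lab 0).IsNil := isNil_bsum lab 0
  have hdN : (bsum lab 1).IsNil := isNil_bsum lab 1
  have heN : (bsum lab 2).IsNil := isNil_bsum lab 2
  -- degenerate case: no variables at all (only the constant coefficient, which vanishes)
  rcases Nat.eq_zero_or_pos (Fintype.card κ) with hN0 | hNpos
  · haveI : IsEmpty κ := Fintype.card_eq_zero_iff.1 hN0
    intro τ
    have hτ : τ = ∅ := Finset.eq_empty_of_isEmpty τ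
    rw [hτ, coeff_sub, coeff_one, if_pos rfl, SqFree.coeff_empty_mul, SqFree.coeff_empty_mul,
      coeff_empty_binomB hcN, coeff_empty_binomB hdN, coeff_empty_binomB ((hcN.add hdN).add heN)]
    norm_num
  obtain ⟨N, hN⟩ : ∃ N, Fintype.card κ = N + 1 := Nat.exists_eq_succ_of_ne_zero hNpos.ne'
  -- notation
  set c : SqFree κ ℝ := bsum lab 0 with hc_def
  set d : SqFree κ ℝ := bsum lab 1 with hd_def
  set e : SqFree κ ℝ := bsum lab 2 with he_def
  set p : ℝ := γ + α with hp_def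
  set q : ℝ := β + α with hq_def
  have hp0 : 0 ≤ p := add_nonneg hγ hα
  have hq0 : 0 ≤ q := add_nonneg hβ hα
  have hp1 : p ≤ 1 := by rw [hp_def]; linarith
  have hq1 : q ≤ 1 := by rw [hq_def]; linarith
  have hα1 : α ≤ 1 := by linarith
  have hαp : α ≤ p := by rw [hp_def]; linarith
  have hαq : α ≤ q := by rw [hq_def]; linarith
  have hpq : p * q ≤ α := by
    calc p * q = (α + β) * (α + γ) := by rw [hp_def, hq_def]; ring
      _ ≤ α := hcorr
  have hcP : c.Nonneg := nonneg_bsum lab 0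
  have hdP : d.Nonneg := nonneg_bsum lab 1
  have heP : e.Nonneg := nonneg_bsum lab 2
  -- the blocks of `c` and of `d`
  set K : Finset κ := Finset.univ.filter fun i => lab i = 0 with hK_def
  set L : Finset κ := Finset.univ.filter fun i => lab i = 1 with hL_def
  have hKL : Disjoint K L := by
    rw [hK_def, hL_def, Finset.disjoint_filter]
    intro i _ h0 h1
    rw [h0] at h1
    exact absurd h1 (by decide)
  have hcK : c.PureOn K := pureOn_bsum lab 0
  have hdL : d.PureOn L := pureOn_bsum lab 1
  -- Sahi's `w = (cd + e)/((1 - c)(1 - d))`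
  set w : SqFree κ ℝ := (c * d + e) * inv1 c * inv1 d with hw_def
  have hcde : (c * d + e).IsNil := (hcN.mul_left d).add heN
  -- the two one-variable binomial powers and the pieces of the decomposition
  set Bc : SqFree κ ℝ := binomB p c with hBc_def
  set Bd : SqFree κ ℝ := binomB q d with hBd_def
  set P : SqFree κ ℝ := 1 - Bc with hP_def
  set Q : SqFree κ ℝ := 1 - Bd with hQ_def
  set X₀ : SqFree κ ℝ := c * binomB (p - 1) c with hX₀_def
  set Y₀ : SqFree κ ℝ := d * binomB (q - 1) d with hY₀_def
  set a : ℕ → ℝ := fun k => (-1 : ℝ) ^ k * rch (k + 1) α with ha_def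
  have ha : ∀ k, 0 ≤ a k := fun k => neg_one_pow_mul_rch_succ_nonneg hα hα1 k
  set term : ℕ → SqFree κ ℝ := fun k =>
    SqFree.C (a k) * (c * d + e) ^ (k + 1) * binomB (p - ((k + 1 : ℕ) : ℝ)) c
      * binomB (q - ((k + 1 : ℕ) : ℝ)) d with hterm_def
  set S : SqFree κ ℝ := ∑ k ∈ Finset.range (N + 1), SqFree.C (a k) * w ^ (k + 1) with hS_def
  set Et : SqFree κ ℝ := SqFree.C α * e * binomB (p - 1) c * binomB (q - 1) d with hEt_def
  -- (1) Sahi's rewriting: `Π'' = (1-c)^{α+γ} (1-d)^{α+β} (1-w)^α`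
  have hPi : binomB γ c * binomB β d * binomB α (c + d + e) = Bc * Bd * (1 - S) := by
    rw [binomB_add_add_eq_mul hcN hdN heN α]
    have hw1 : binomB α w = 1 - S := by
      rw [hS_def, binomB_eq_one_sub, hN]
    calc binomB γ c * binomB β d * (binomB α c * binomB α d * binomB α w)
        = (binomB γ c * binomB α c) * (binomB β d * binomB α d) * binomB α w := by ring
      _ = Bc * Bd * (1 - S) := by
        rw [binomB_mul_binomB_same hcN, binomB_mul_binomB_same hdN, hw1]
  -- (2) multiplying out: `(1-c)^p (1-d)^q Σ_k a_k w^{k+1} = Σ_k term k`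
  have hterm : ∀ k, term k = Bc * Bd * (SqFree.C (a k) * w ^ (k + 1)) := by
    intro k
    rw [hterm_def]
    simp only []
    rw [binomB_sub_natCast hcN p (k + 1), binomB_sub_natCast hdN q (k + 1), hw_def, mul_pow, mul_pow]
    ring
  have hS : Bc * Bd * S = ∑ k ∈ Finset.range (N + 1), term k := by
    rw [hS_def, Finset.mul_sum]
    exact Finset.sum_congr rfl fun k _ => (hterm k).symm
  -- (3) every `term k` is nonnegative (exponents `p - (k+1) ≤ 0`, `q - (k+1) ≤ 0`)
  have hterm_nonneg : ∀ k, (term k).Nonneg := by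
    intro k
    have hk : (1 : ℝ) ≤ ((k + 1 : ℕ) : ℝ) := by exact_mod_cast Nat.succ_le_succ (Nat.zero_le k)
    have e1 : p - ((k + 1 : ℕ) : ℝ) ≤ 0 := by linarith
    have e2 : q - ((k + 1 : ℕ) : ℝ) ≤ 0 := by linarith
    exact (((Nonneg.C_mul (ha k) (((hcP.mul hdP).add heP).pow (k + 1))).mul
      (Nonneg.binomB_of_nonpos e1 hcP)).mul (Nonneg.binomB_of_nonpos e2 hdP))
  -- (4) the `k = 0` term: `α (cd + e) (1-c)^{p-1} (1-d)^{q-1} = α X₀ Y₀ + Et`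
  have h0 : term 0 = SqFree.C α * X₀ * Y₀ + Et := by
    rw [hterm_def, hEt_def, hX₀_def, hY₀_def]
    simp only [ha_def, pow_zero, one_mul, zero_add, rch_one, pow_one, Nat.cast_one]
    ring
  -- (5) assembling: `1 - Π'' = P + Q + Σ_{k≥1} term k + Et + (α X₀ Y₀ - P Q)`
  have heq : 1 - binomB γ c * binomB β d * binomB α (c + d + e)
      = P + Q + (∑ k ∈ Finset.range N, term (k + 1)) + Et + (SqFree.C α * X₀ * Y₀ - P * Q) := by
    rw [hPi]
    calc 1 - Bc * Bd * (1 - S) = (1 - Bc * Bd) + Bc * Bd * S := by ring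
      _ = (1 - Bc * Bd) + ((∑ k ∈ Finset.range N, term (k + 1)) + (SqFree.C α * X₀ * Y₀ + Et)) := by
        rw [hS, Finset.sum_range_succ', h0]
      _ = P + Q + (∑ k ∈ Finset.range N, term (k + 1)) + Et + (SqFree.C α * X₀ * Y₀ - P * Q) := by
        rw [hP_def, hQ_def]; ring
  rw [heq]
  -- (6) the key comparison `P Q ≤ α X₀ Y₀` coefficientwise on the two disjoint blocks
  have hPn : P.Nonneg := Nonneg.one_sub_binomB_of_unit hp0 hp1 hcP
  have hQn : Q.Nonneg := Nonneg.one_sub_binomB_of_unit hq0 hq1 hdP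
  have hPnil : P.IsNil := isNil_one_sub_binomB hcN p
  have hQnil : Q.IsNil := isNil_one_sub_binomB hdN q
  have hPK : P.PureOn K := PureOn.one.sub (PureOn.binomB p hcK)
  have hQL : Q.PureOn L := PureOn.one.sub (PureOn.binomB q hdL)
  have hxK : (SqFree.C α * X₀).PureOn K := (PureOn.C α).mul (hcK.mul (PureOn.binomB _ hcK))
  have hyL : Y₀.PureOn L := hdL.mul (PureOn.binomB _ hdL)
  -- `D P = p · X₀` and `D Q = q · Y₀` (the degree derivation; `D c = c`)
  have hDP : D P = SqFree.C p * X₀ := by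
    rw [hP_def, hBc_def, D_sub, D_one, D_binomB hcN, hc_def, D_bsum, hX₀_def]; ring
  have hDQ : D Q = SqFree.C q * Y₀ := by
    rw [hQ_def, hBd_def, D_sub, D_one, D_binomB hdN, hd_def, D_bsum, hY₀_def]; ring
  have hDPσ : ∀ σ : Finset κ, (σ.card : ℝ) * P.coeff σ = p * X₀.coeff σ := by
    intro σ
    have h := congrArg (fun z => z.coeff σ) hDP
    simpa only [coeff_D, coeff_C_mul] using h
  have hDQρ : ∀ ρ : Finset κ, (ρ.card : ℝ) * Q.coeff ρ = q * Y₀.coeff ρ := by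
    intro ρ
    have h := congrArg (fun z => z.coeff ρ) hDQ
    simpa only [coeff_D, coeff_C_mul] using h
  have hkey : (SqFree.C α * X₀ * Y₀ - P * Q).Nonneg := by
    refine nonneg_mul_sub_mul_of_pureOn hKL hxK hPK hyL hQL fun σ _ ρ _ => ?_
    rw [coeff_C_mul]
    have hPσ : 0 ≤ P.coeff σ := hPn σ
    have hQρ : 0 ≤ Q.coeff ρ := hQn ρ
    -- the degenerate exponents
    by_cases hp : p = 0
    · have hα0 : α = 0 := le_antisymm (hp ▸ hαp) hα
      have hP0 : P = 0 := by rw [hP_def, hBc_def, hp, binomB_zero_left, sub_self]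
      rw [hP0, coeff_zero, zero_mul, hα0, zero_mul, zero_mul]
    by_cases hq : q = 0
    · have hα0 : α = 0 := le_antisymm (hq ▸ hαq) hα
      have hQ0 : Q = 0 := by rw [hQ_def, hBd_def, hq, binomB_zero_left, sub_self]
      rw [hQ0, coeff_zero, mul_zero, hα0, zero_mul, zero_mul]
    have hp' : 0 < p := lt_of_le_of_ne hp0 (Ne.symm hp)
    have hq' : 0 < q := lt_of_le_of_ne hq0 (Ne.symm hq)
    -- empty index sets: both sides vanish
    by_cases hσ : σ = ∅
    · have hX : X₀.coeff σ = 0 := by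
        have h := hDPσ σ
        rw [hσ, Finset.card_empty, Nat.cast_zero, zero_mul] at h
        rw [hσ]
        exact (mul_eq_zero.1 h.symm).resolve_left hp
      have hPe : P.coeff σ = 0 := by rw [hσ]; exact hPnil
      rw [hX, hPe, zero_mul, mul_zero, zero_mul]
    by_cases hρ : ρ = ∅
    · have hY : Y₀.coeff ρ = 0 := by
        have h := hDQρ ρ
        rw [hρ, Finset.card_empty, Nat.cast_zero, zero_mul] at h
        rw [hρ]
        exact (mul_eq_zero.1 h.symm).resolve_left hq
      have hQe : Q.coeff ρ = 0 := by rw [hρ]; exact hQnil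
      rw [hY, hQe, mul_zero, mul_zero]
    -- generic case: `k = |σ| ≥ 1`, `l = |ρ| ≥ 1`, and `α k l ≥ α ≥ p q`
    have hk : (1 : ℝ) ≤ σ.card := by
      exact_mod_cast Finset.card_pos.2 (Finset.nonempty_iff_ne_empty.2 hσ)
    have hl : (1 : ℝ) ≤ ρ.card := by
      exact_mod_cast Finset.card_pos.2 (Finset.nonempty_iff_ne_empty.2 hρ)
    have hkl : (1 : ℝ) ≤ (σ.card : ℝ) * (ρ.card : ℝ) := one_le_mul_of_one_le_of_one_le hk hl
    have hPQ : 0 ≤ P.coeff σ * Q.coeff ρ := mul_nonneg hPσ hQρ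
    have hmain : p * q * (P.coeff σ * Q.coeff ρ) ≤ p * q * (α * X₀.coeff σ * Y₀.coeff ρ) := by
      calc p * q * (P.coeff σ * Q.coeff ρ)
          ≤ α * (P.coeff σ * Q.coeff ρ) := mul_le_mul_of_nonneg_right hpq hPQ
        _ ≤ α * (((σ.card : ℝ) * P.coeff σ) * ((ρ.card : ℝ) * Q.coeff ρ)) := by
          refine mul_le_mul_of_nonneg_left ?_ hα
          calc P.coeff σ * Q.coeff ρ = 1 * (P.coeff σ * Q.coeff ρ) := (one_mul _).symm
            _ ≤ ((σ.card : ℝ) * (ρ.card : ℝ)) * (P.coeff σ * Q.coeff ρ) :=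
                mul_le_mul_of_nonneg_right hkl hPQ
            _ = ((σ.card : ℝ) * P.coeff σ) * ((ρ.card : ℝ) * Q.coeff ρ) := by ring
        _ = α * ((p * X₀.coeff σ) * (q * Y₀.coeff ρ)) := by rw [hDPσ σ, hDQρ ρ]
        _ = p * q * (α * X₀.coeff σ * Y₀.coeff ρ) := by ring
    exact le_of_mul_le_mul_left hmain (mul_pos hp' hq')
  -- (7) the remaining pieces are nonnegative outright
  have hEt : Et.Nonneg := by
    have e1 : p - 1 ≤ 0 := by linarith
    have e2 : q - 1 ≤ 0 := by linarith
    exact (((Nonneg.C_mul hα heP)).mul (Nonneg.binomB_of_nonpos e1 hcP)).mul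
      (Nonneg.binomB_of_nonpos e2 hdP)
  exact (((hPn.add hQn).add (Nonneg.sum fun k _ => hterm_nonneg (k + 1))).add hEt).add hkey

end PartG

end SqFree

/-! ### Event form of the core: two positively correlated `{0,1}`-valued functions -/

section CorrPair

open SqFree

variable {α : Type*} [Fintype α]

omit [Fintype α] in
/-- The linear form `Σ_i t_i f_i(x)` of a LABELLED family `f_i = G_{lab i}` is the labelled
combination `Σ_j G_j(x) · T_j` of the block sums. [folklore] -/
private theorem lin_label (G : Fin 3 → α → ℝ) {n : ℕ} (lab : Fin n → Fin 3) (x : α) :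
    lin (fun i => G (lab i)) x = ∑ j : Fin 3, SqFree.C (G j x) * bsum lab j := by
  calc lin (fun i => G (lab i)) x
      = ∑ i : Fin n, ∑ j : Fin 3, (if lab i = j then SqFree.C (G j x) * single {i} 1 else 0) := by
        rw [lin]
        refine Finset.sum_congr rfl fun i _ => ?_
        rw [Finset.sum_ite_eq]
        simp only [Finset.mem_univ, if_true, C_mul_single, mul_one]
    _ = ∑ j : Fin 3, ∑ i : Fin n, (if lab i = j then SqFree.C (G j x) * single {i} 1 else 0) :=
        Finset.sum_comm
    _ = ∑ j : Fin 3, SqFree.C (G j x) * bsum lab j := by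
        refine Finset.sum_congr rfl fun j _ => ?_
        rw [bsum, Finset.mul_sum]
        refine Finset.sum_congr rfl fun i _ => ?_
        split_ifs
        · rfl
        · rw [mul_zero]

omit [Fintype α] in
/-- One factor of Sahi's product for a labelled family drawn from `{g₁, g₂, g₁g₂}`: according to the
value pattern `(g₁(x), g₂(x)) ∈ {0,1}²` the factor `(1 - Σ_i t_i f_i(x))^{μ(x)}` is `1`, `(1-c)^{μ x}`,
`(1-d)^{μ x}` or `(1-c-d-e)^{μ x}`. [cite: Sahi2008, proof of Prop. 15 (p. 223): the four factors of Π] -/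
private theorem binomB_lin_label (m : ℝ) (g₁ g₂ : α → ℝ) (x : α) (h₁ : g₁ x = 0 ∨ g₁ x = 1)
    (h₂ : g₂ x = 0 ∨ g₂ x = 1) {n : ℕ} (lab : Fin n → Fin 3) :
    binomB m (lin (fun i => (![g₁, g₂, g₁ * g₂] : Fin 3 → α → ℝ) (lab i)) x)
      = binomB (m * (g₁ x * (1 - g₂ x))) (bsum lab 0) * binomB (m * (g₂ x * (1 - g₁ x))) (bsum lab 1)
        * binomB (m * (g₁ x * g₂ x)) (bsum lab 0 + bsum lab 1 + bsum lab 2) := by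
  have hG0 : (![g₁, g₂, g₁ * g₂] : Fin 3 → α → ℝ) 0 = g₁ := rfl
  have hG1 : (![g₁, g₂, g₁ * g₂] : Fin 3 → α → ℝ) 1 = g₂ := rfl
  have hG2 : (![g₁, g₂, g₁ * g₂] : Fin 3 → α → ℝ) 2 = g₁ * g₂ := rfl
  rw [lin_label, Fin.sum_univ_three, hG0, hG1, hG2, Pi.mul_apply]
  rcases h₁ with h₁ | h₁ <;> rcases h₂ with h₂ | h₂ <;>
    simp only [h₁, h₂, mul_zero, zero_mul, mul_one, one_mul, sub_zero, sub_self, map_zero, map_one,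
      zero_add, add_zero, binomB_zero_left, binomB_zero_right]

/-- **Sahi 2008, Proposition 15 — the core in event form (Lemma 16 with `a = b = 0`, read through
Proposition 12).**  For a probability weight `μ` on a finite set and two `{0,1}`-valued functions
`g₁, g₂` with `E(g₁)E(g₂) ≤ E(g₁g₂)`, Sahi's functional is nonnegative on every `n`-tuple drawn from
`{g₁, g₂, g₁g₂}` (in any order and multiplicities): `E_n(f_0,…,f_{n-1}) ≥ 0`, `f_i = (g₁, g₂, g₁g₂)_{lab i}`.
(On `2^{{1,2}}` with an FKG weight: `g₁ = 1_{∋1}`, `g₂ = 1_{∋2}`, `g₁g₂ = 1_{{1,2}}`, and the hypothesis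
is `(α+γ)(α+β) ≤ α`.)  [cite: Sahi2008, Prop. 15 (p. 222) with Lemma 16 (pp. 223–226) and Prop. 12 (p. 219)] -/
theorem sahiE_nonneg_of_corrPair_labels (μ : α → ℝ) (hμ0 : ∀ x, 0 ≤ μ x) (hμ1 : ∑ x, μ x = 1)
    (g₁ g₂ : α → ℝ) (h₁ : ∀ x, g₁ x = 0 ∨ g₁ x = 1) (h₂ : ∀ x, g₂ x = 0 ∨ g₂ x = 1)
    (hcorr : ex μ g₁ * ex μ g₂ ≤ ex μ (g₁ * g₂)) {n : ℕ} (lab : Fin n → Fin 3) :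
    0 ≤ sahiE μ n (fun i => (![g₁, g₂, g₁ * g₂] : Fin 3 → α → ℝ) (lab i)) := by
  rw [sahiE_eq_gfE μ hμ1, gfE]
  have hcde : (bsum lab 0 + bsum lab 1 + bsum lab 2).IsNil :=
    ((isNil_bsum lab 0).add (isNil_bsum lab 1)).add (isNil_bsum lab 2)
  have hprod : ∏ x, binomB (μ x) (lin (fun i => (![g₁, g₂, g₁ * g₂] : Fin 3 → α → ℝ) (lab i)) x)
      = binomB (∑ x, μ x * (g₁ x * (1 - g₂ x))) (bsum lab 0)
        * binomB (∑ x, μ x * (g₂ x * (1 - g₁ x))) (bsum lab 1)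
        * binomB (∑ x, μ x * (g₁ x * g₂ x)) (bsum lab 0 + bsum lab 1 + bsum lab 2) := by
    rw [Finset.prod_congr rfl fun x _ => binomB_lin_label (μ x) g₁ g₂ x (h₁ x) (h₂ x) lab,
      Finset.prod_mul_distrib, Finset.prod_mul_distrib,
      prod_binomB_eq_binomB_sum _ _ (isNil_bsum lab 0), prod_binomB_eq_binomB_sum _ _ (isNil_bsum lab 1),
      prod_binomB_eq_binomB_sum _ _ hcde]
  rw [hprod]
  -- bounds on the values of `g₁, g₂`
  have hv : ∀ x, 0 ≤ g₁ x * (1 - g₂ x) ∧ 0 ≤ g₂ x * (1 - g₁ x) ∧ 0 ≤ g₁ x * g₂ x ∧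
      g₁ x + g₂ x - g₁ x * g₂ x ≤ 1 := by
    intro x
    rcases h₁ x with h | h <;> rcases h₂ x with h' | h' <;> simp only [h, h'] <;> norm_num
  have hγ : 0 ≤ ∑ x, μ x * (g₁ x * (1 - g₂ x)) :=
    Finset.sum_nonneg fun x _ => mul_nonneg (hμ0 x) (hv x).1
  have hβ : 0 ≤ ∑ x, μ x * (g₂ x * (1 - g₁ x)) :=
    Finset.sum_nonneg fun x _ => mul_nonneg (hμ0 x) (hv x).2.1
  have hα : 0 ≤ ∑ x, μ x * (g₁ x * g₂ x) :=
    Finset.sum_nonneg fun x _ => mul_nonneg (hμ0 x) (hv x).2.2.1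
  have hsum : (∑ x, μ x * (g₁ x * g₂ x)) + (∑ x, μ x * (g₂ x * (1 - g₁ x)))
      + (∑ x, μ x * (g₁ x * (1 - g₂ x))) ≤ 1 := by
    calc (∑ x, μ x * (g₁ x * g₂ x)) + (∑ x, μ x * (g₂ x * (1 - g₁ x)))
          + (∑ x, μ x * (g₁ x * (1 - g₂ x)))
        = ∑ x, μ x * (g₁ x + g₂ x - g₁ x * g₂ x) := by
          rw [← Finset.sum_add_distrib, ← Finset.sum_add_distrib]
          exact Finset.sum_congr rfl fun x _ => by ring
      _ ≤ ∑ x, μ x * 1 := Finset.sum_le_sum fun x _ => mul_le_mul_of_nonneg_left (hv x).2.2.2 (hμ0 x)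
      _ = 1 := by simp [hμ1]
  have e1 : (∑ x, μ x * (g₁ x * g₂ x)) + (∑ x, μ x * (g₂ x * (1 - g₁ x))) = ex μ g₂ := by
    rw [ex, ← Finset.sum_add_distrib]
    exact Finset.sum_congr rfl fun x _ => by ring
  have e2 : (∑ x, μ x * (g₁ x * g₂ x)) + (∑ x, μ x * (g₁ x * (1 - g₂ x))) = ex μ g₁ := by
    rw [ex, ← Finset.sum_add_distrib]
    exact Finset.sum_congr rfl fun x _ => by ring
  have hc' : ((∑ x, μ x * (g₁ x * g₂ x)) + (∑ x, μ x * (g₂ x * (1 - g₁ x))))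
      * ((∑ x, μ x * (g₁ x * g₂ x)) + (∑ x, μ x * (g₁ x * (1 - g₂ x))))
        ≤ ∑ x, μ x * (g₁ x * g₂ x) := by
    rw [e1, e2, mul_comm]
    exact hcorr
  exact nonneg_one_sub_core lab hα hβ hγ hsum hc' Finset.univ

end CorrPair

end Literature.Combinatorics.Sahi2008
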